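import Literature.Analysis.FunctionSpaces.SobolevDomain
import Mathlib.Analysis.Calculus.FDeriv.Symmetric
import Literature.Analysis.FunctionSpaces.MeyersSerrinProofs
import Literature.Analysis.FunctionSpaces.SobolevDomainNormProofs
import Mathlib.MeasureTheory.Function.ConvergenceInMeasure
import Mathlib.MeasureTheory.Integral.DominatedConvergence
import Mathlib.Analysis.InnerProductSpace.PiL2
import Mathlib.Analysis.InnerProductSpace.Calculus
import Mathlib.Analysis.SpecialFunctions.Sqrt
import Mathlib.Analysis.SpecialFunctions.SmoothTransition
import Mathlib.Analysis.Calculus.MeanValue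
import Literature.Analysis.PDE.MinimisingMapsCompetitors
import HarnessLib

/-!
# Energy minimising maps `Q → S³`, III: the Sobolev chain rule, the Hardt–Kinderlehrer–Lin shell competitor — `MinimisingMapCompactness` HOLDS (re-homed proofs)

**Compactness of energy minimising maps `Q → S³` (Luckhaus 1988; Simon, *Theorems on Regularity and Singularity of Energy Minimizing
Maps* (1996), §2.9 Lemma 1 with Remarks (1)–(2)), proved along Hardt–Kinderlehrer–Lin (Comm. Math. Phys. 105 (1986), §2) — the named fact
`Literature.Analysis.PDE.MinimisingMapCompactness` (`HarmonicMapMinimisers.lean`) HOLDS, EXACT name `Literature.Analysis.PDE.MinimisingMapCompactness_holds`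
(this file, 3 of 3).**  Every sequence of finite-energy unit `W^{1,2}` maps on the open unit cube `Q ⊂ ℝ³`, each minimising the Dirichlet energy on every
ball `B̄_ρ(y) ⊆ Q` against unit competitors agreeing with it off a smaller concentric ball, with bounded energies, has a subsequence converging in
`L²` on every such ball to a minimiser of the same class, with convergence of the energies [Simon1996] [Luckhaus1988] [HardtKinderlehrerLin1986].
Contents of the three files: (I) interior Rellich–Kondrachov in net form and strong `L²` compactness for sequences bounded in `L^∞ ∩ W^{1,2}`
[Evans2010], dyadic cells / dyadic means and weak limits, the everywhere-unit representative and locality of weak gradients, extraction on the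
cube; (II) competitor transfer (the ball-splitting inequality), the radial pigeonhole, energy convergence and ball-minimality of the limit modulo
the Hardt–Kinderlehrer–Lin shell-competitor hypothesis, the compactness theorem modulo that hypothesis, the Sobolev shell interpolant, HKL averaging,
the sphere ray projection; (III) the nonlinear Sobolev chain rule [Ziemer1989] [EvansGariepy1992], the ray-projection calculus, the HKL shell
competitor, and `MinimisingMapCompactness_holds`.
RE-HOMED into `Literature/` by the Hodge foundations lane (`lit-hodgefound`, seat p20, generation 40): verbatim DECLARATION-LEVEL ports (the 149
theorems needed, in dependency order; each Part is one Summits module) of 30 theorem-only modules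
`Summits/QuantumFields/YangMills/Theorems/PoincareLipschitz{SobolevLocalL2Net,SobolevL2Compactness,BlowDownCells,SamplingCells,BlowDownModulus,
BlowDownL2Compactness,DyadicMeansWeakLimit(Cube),LatticeToContinuumSobolevLetters,BlowDownWeakGradientLetters,SobolevCubeExtraction(Letters),
CompetitorTransfer,ShellPigeonhole,MinimisingMapCompactness{Letters,Energy,Minimality,∅,Holds},SobolevShellInterpolation(Balls),ProjectionAveraging(Continuum),
SphereRayProjection(Calculus),WeakChainRuleShear,SobolevChainRule(ByApproximation),SobolevRayProjectionComp,HKLCompetitor}.lean`; the thirty module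
namespaces `Summit.QuantumFields.YangMills.Theorems.PoincareLipschitz*` are COLLAPSED into the single namespace `Literature.Analysis.PDE.MinimisingMaps`
(short names are pairwise distinct; the intra-cone `open … (…)` lines are dropped).  Theorem-only files: no definition, no new named fact (D-0026);
imports Mathlib/Literature only (`Literature/Analysis/FunctionSpaces/{MeyersSerrin,SobolevDomain*,SobolevDifferenceQuotients,SobolevTraceDensity,
WeakDerivInner,DiagonalWeakLimits}`, `Literature/Analysis/Calculus/RadialCutoff`, `Literature/MathematicalPhysics/QuantumFieldTheory/Balaban1983to89/B4Eq19LatticeOperators`);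
every declaration carries the citation of the printed statement it formalises or serves.  The Summits originals stay in place (transitional
duplication).  WHAT THIS IS NOT: nothing here bears on Yang–Mills existence or the mass gap or any summit statement; it is the variational
compactness theory of harmonic maps into `S³` on the unit cube of `ℝ³` (the companion fact `MinimisingMapSmoothness`, Schoen–Uhlenbeck 1984,
remains a named fact).
-/

noncomputable section

/-!
## Part 1 — port of `Summits/QuantumFields/YangMills/Theorems/PoincareLipschitzWeakChainRuleShear.lean` (1 declarations kept)

# Energy minimising maps into `S³` (Hardt–Kinderlehrer–Lin / Luckhaus / Simon §2.9): Weak Chain Rule Shear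

Declarations of this Part (verbatim port; each keeps its own docstring and citation): `integrableOn_smul_of_locallyIntegrableOn`.

Reference keys (see `references.bib` and the declarations' citations): [Evans2010], [Ziemer1989], [Simon1996].
-/

section Part1

open _root_.MeasureTheory _root_.Set _root_.Function _root_.Filter _root_.Topology _root_.Metric _root_.TopologicalSpace
open scoped _root_.ContDiff

namespace Literature.Analysis.PDE.MinimisingMaps

open Literature.Analysis.FunctionSpaces (IsTestFunctionOn HasWeakFDerivOn)

variable {E : Type*} [NormedAddCommGroup E] [NormedSpace ℝ E]
variable {h : E → ℝ} {e : E} {L : ℝ}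

/-! ## §1 Smoothness letters for the shear data -/

omit [NormedSpace ℝ E] in
/-- **A continuous, compactly supported multiplier times a locally integrable function is integrable on `Ω`.**
[cite: Evans2010, §5.2.1] -/
theorem integrableOn_smul_of_locallyIntegrableOn [MeasurableSpace E] [OpensMeasurableSpace E] {μ : Measure E}
    {F : Type*} [NormedAddCommGroup F] [NormedSpace ℝ F] {Ω : Opens E} {f : E → F}
    (hf : LocallyIntegrableOn f (Ω : Set E) μ) {c : E → ℝ} (hc : Continuous c) (hcs : HasCompactSupport c)
    (hcΩ : tsupport c ⊆ (Ω : Set E)) : IntegrableOn (fun x => c x • f x) (Ω : Set E) μ := by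
  have hK : IntegrableOn (fun x => c x • f x) (tsupport c) μ :=
    (hf.integrableOn_compact_subset hcΩ hcs).continuousOn_smul hc.continuousOn hcs
  refine hK.of_forall_sdiff_eq_zero Ω.isOpen.measurableSet fun x hx => ?_
  rw [image_eq_zero_of_notMem_tsupport hx.2, zero_smul]

variable [MeasurableSpace E] [BorelSpace E] [FiniteDimensional ℝ E] {μ : Measure E} [μ.IsAddHaarMeasure]
variable {F : Type*} [NormedAddCommGroup F] [NormedSpace ℝ F]

end Literature.Analysis.PDE.MinimisingMaps

end Part1

/-!
## Part 2 — port of `Summits/QuantumFields/YangMills/Theorems/PoincareLipschitzSobolevChainRule.lean` (3 declarations kept)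

# Energy minimising maps into `S³` (Hardt–Kinderlehrer–Lin / Luckhaus / Simon §2.9): Sobolev Chain Rule

Declarations of this Part (verbatim port; each keeps its own docstring and citation): `norm_sub_le_of_fderiv_bounded`, `tendsto_eLpNorm_of_tendsto_eSobolevDomainNorm`, `hasWeakFDerivOn_comp_of_fderiv_bounded`.

Reference keys (see `references.bib` and the declarations' citations): [Ziemer1989], [EvansGariepy1992], [MeyersSerrin1964].
-/

section Part2

open _root_.MeasureTheory _root_.Set _root_.Function _root_.Filter _root_.Topology _root_.Metric _root_.TopologicalSpace
open scoped _root_.ContDiff _root_.ENNReal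

namespace Literature.Analysis.PDE.MinimisingMaps

open Literature.Analysis.FunctionSpaces

variable {E : Type*} [NormedAddCommGroup E] [InnerProductSpace ℝ E] [FiniteDimensional ℝ E]
  [MeasurableSpace E] [BorelSpace E] {μ : Measure E} [μ.IsAddHaarMeasure]
variable {F : Type*} [NormedAddCommGroup F] [NormedSpace ℝ F] [CompleteSpace F]
variable {F' : Type*} [NormedAddCommGroup F'] [NormedSpace ℝ F']

/-! ## §1 Letters -/

omit [InnerProductSpace ℝ E] [FiniteDimensional ℝ E] [MeasurableSpace E] [BorelSpace E] [CompleteSpace F] in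
/-- **A `C¹` map with `‖DN‖ ≤ C` is `C`-Lipschitz.** [cite: Ziemer1989, Thm 2.1.11; EvansGariepy1992, §4.2.2 Thm 4 (ii)] -/
theorem norm_sub_le_of_fderiv_bounded [NormedSpace ℝ E] {N : F → F'} (hN : Differentiable ℝ N) {C : ℝ}
    (hC : ∀ y, ‖fderiv ℝ N y‖ ≤ C) (a b : F) : ‖N a - N b‖ ≤ C * ‖a - b‖ :=
  Convex.norm_image_sub_le_of_norm_fderiv_le (fun y _ => hN y) (fun y _ => hC y) convex_univ (mem_univ b) (mem_univ a)

/-- **From `W^{1,1}` convergence to `L¹` convergence of the function and of each directional derivative.** [cite: Ziemer1989, Thm 2.1.11; EvansGariepy1992, §4.2.2 Thm 4 (ii)] -/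
theorem tendsto_eLpNorm_of_tendsto_eSobolevDomainNorm {Ω : Opens E} {w : E → F} {Gw : E → E →L[ℝ] F}
    (hw : HasWeakFDerivOn Ω μ w Gw) {u : ℕ → E → F} (hu : ∀ n, ContDiffOn ℝ ∞ (u n) (Ω : Set E))
    (hlim : Tendsto (fun n => eSobolevDomainNorm 1 1 Ω μ (w - u n)) atTop (𝓝 0)) :
    Tendsto (fun n => eLpNorm (fun x => w x - u n x) 1 (μ.restrict (Ω : Set E))) atTop (𝓝 0) ∧
      ∀ v : E, Tendsto (fun n => eLpNorm (fun x => Gw x v - fderiv ℝ (u n) x v) 1 (μ.restrict (Ω : Set E)))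
        atTop (𝓝 0) := by
  have hsub : ∀ n, HasWeakFDerivOn Ω μ (w - u n) (Gw - fderiv ℝ (u n)) :=
    fun n => hw.sub (MeyersSerrin.hasWeakFDerivOn_of_contDiffOn (μ := μ) (hu n))
  have hle0 : ∀ n, eLpNorm (fun x => w x - u n x) 1 (μ.restrict (Ω : Set E)) ≤ eSobolevDomainNorm 1 1 Ω μ (w - u n) :=
    fun n => eLpNorm_le_eSobolevDomainNorm
  refine ⟨tendsto_of_tendsto_of_tendsto_of_le_of_le tendsto_const_nhds hlim (fun _ => bot_le) hle0, ?_⟩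
  -- basis components
  set b := Module.finBasis ℝ E
  have hcomp : ∀ i, Tendsto (fun n => eLpNorm (fun x => (Gw x - fderiv ℝ (u n) x) (b i)) 1 (μ.restrict (Ω : Set E)))
      atTop (𝓝 0) := by
    intro i
    refine tendsto_of_tendsto_of_tendsto_of_le_of_le tendsto_const_nhds hlim (fun _ => bot_le) fun n => ?_
    rw [MeyersSerrin.eSobolevDomainNorm_succ_eq (hsub n)]
    refine le_trans ?_ le_add_self
    have := Finset.single_le_sum (f := fun i => eSobolevDomainNorm 0 1 Ω μ (fun x => (Gw - fderiv ℝ (u n)) x (b i)))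
      (fun _ _ => bot_le) (Finset.mem_univ i)
    simpa only [eSobolevDomainNorm_zero, Pi.sub_apply] using this
  intro v
  -- expand `v` in the basis
  have hv : ∀ (T : E →L[ℝ] F), T v = ∑ i, b.repr v i • T (b i) := fun T => by
    conv_lhs => rw [← b.sum_repr v]
    rw [map_sum]
    exact Finset.sum_congr rfl fun i _ => by rw [map_smul]
  have hle : ∀ n, eLpNorm (fun x => Gw x v - fderiv ℝ (u n) x v) 1 (μ.restrict (Ω : Set E)) ≤
      ∑ i, ‖b.repr v i‖ₑ * eLpNorm (fun x => (Gw x - fderiv ℝ (u n) x) (b i)) 1 (μ.restrict (Ω : Set E)) := by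
    intro n
    have heq : (fun x => Gw x v - fderiv ℝ (u n) x v) =
        ∑ i, (fun x => b.repr v i • (Gw x - fderiv ℝ (u n) x) (b i)) := by
      funext x
      rw [Finset.sum_apply, ← sub_apply, hv]
    rw [heq]
    refine (eLpNorm_sum_le (fun i _ => ?_) le_rfl).trans (Finset.sum_le_sum fun i _ => ?_)
    · exact ((hsub n).aestronglyMeasurable_deriv_apply (b i)).const_smul _
    · have : (fun x => b.repr v i • (Gw x - fderiv ℝ (u n) x) (b i)) =
          b.repr v i • (fun x => (Gw x - fderiv ℝ (u n) x) (b i)) := rfl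
      rw [this, eLpNorm_const_smul]
  have hlim' : Tendsto (fun n => ∑ i, ‖b.repr v i‖ₑ *
      eLpNorm (fun x => (Gw x - fderiv ℝ (u n) x) (b i)) 1 (μ.restrict (Ω : Set E))) atTop (𝓝 0) := by
    have : (0 : ℝ≥0∞) = ∑ i : Fin (Module.finrank ℝ E), ‖b.repr v i‖ₑ * 0 := by simp
    rw [this]
    exact tendsto_finsetSum _ fun i _ => ENNReal.Tendsto.const_mul (hcomp i) (Or.inr enorm_ne_top)
  exact tendsto_of_tendsto_of_tendsto_of_le_of_le tendsto_const_nhds hlim' (fun _ => bot_le) hle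

/-! ## §2 The chain rule -/

/-- **THE NONLINEAR CHAIN RULE FOR SOBOLEV MAPS.**  `w` weakly differentiable on the open `Ω` with weak gradient `Gw`,
`N ∈ C^∞(F, F′)` with `‖DN‖ ≤ C` everywhere ⇒ `N ∘ w` is weakly differentiable on `Ω` with weak gradient
`x ↦ DN(w x) ∘ Gw x`.  Proof: Meyers–Serrin on a compactly contained neighbourhood of the support of the test function,
classical identity for `N ∘ u_n`, limits by the Lipschitz bound and dominated convergence along an a.e.-convergent
subsequence. [cite: Ziemer1989, Thm 2.1.11; EvansGariepy1992, §4.2.2 Thm 4 (ii)] -/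
theorem hasWeakFDerivOn_comp_of_fderiv_bounded {Ω : Opens E} {w : E → F} {Gw : E → E →L[ℝ] F}
    (hw : HasWeakFDerivOn Ω μ w Gw) {N : F → F'} (hN : ContDiff ℝ ∞ N) {C : ℝ} (hC : ∀ y, ‖fderiv ℝ N y‖ ≤ C) :
    HasWeakFDerivOn Ω μ (fun x => N (w x)) (fun x => (fderiv ℝ N (w x)).comp (Gw x)) := by
  have hNd : Differentiable ℝ N := hN.differentiable (by simp)
  have hNc : Continuous N := hN.continuous
  have hN'c : Continuous (fderiv ℝ N) := hN.continuous_fderiv (by simp)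
  have hC0 : 0 ≤ C := (norm_nonneg _).trans (hC 0)
  have hΩlc : IsLocallyClosed (Ω : Set E) := Ω.isOpen.isLocallyClosed
  refine ⟨?_, ?_, fun φ v hφ => ?_⟩
  · -- local integrability of `N ∘ w`
    rw [locallyIntegrableOn_iff hΩlc]
    intro K hK hKc
    have hwK : IntegrableOn w K μ := hw.locallyIntegrableOn.integrableOn_compact_subset hK hKc
    have hm : AEStronglyMeasurable (fun x => N (w x)) (μ.restrict K) :=
      hNc.comp_aestronglyMeasurable hwK.aestronglyMeasurable
    have hbound : IntegrableOn (fun x => ‖N 0‖ + C * ‖w x‖) K μ :=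
      (integrableOn_const (hKc.measure_lt_top (μ := μ)).ne).add (hwK.norm.const_mul C)
    refine Integrable.mono' hbound hm (Filter.Eventually.of_forall fun x => ?_)
    have h1 := norm_sub_le_of_fderiv_bounded (E := E) hNd hC (w x) 0
    rw [sub_zero] at h1
    calc ‖N (w x)‖ = ‖(N (w x) - N 0) + N 0‖ := by rw [sub_add_cancel]
      _ ≤ ‖N (w x) - N 0‖ + ‖N 0‖ := norm_add_le _ _
      _ ≤ ‖N 0‖ + C * ‖w x‖ := by linarith
  · -- local integrability of `DN(w) ∘ Gw`
    rw [locallyIntegrableOn_iff hΩlc]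
    intro K hK hKc
    have hGK : IntegrableOn Gw K μ := hw.locallyIntegrableOn_deriv.integrableOn_compact_subset hK hKc
    have hwK : IntegrableOn w K μ := hw.locallyIntegrableOn.integrableOn_compact_subset hK hKc
    have hm : AEStronglyMeasurable (fun x => (fderiv ℝ N (w x)).comp (Gw x)) (μ.restrict K) := by
      have := (ContinuousLinearMap.compL ℝ E F F').aestronglyMeasurable_comp₂
        (hN'c.comp_aestronglyMeasurable hwK.aestronglyMeasurable) hGK.aestronglyMeasurable
      simpa only [ContinuousLinearMap.compL_apply] using this
    refine Integrable.mono' (hGK.norm.const_mul C) hm (Filter.Eventually.of_forall fun x => ?_)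
    exact (ContinuousLinearMap.opNorm_comp_le _ _).trans (mul_le_mul_of_nonneg_right (hC _) (norm_nonneg _))
  · -- the integration-by-parts identity
    -- (1) a compactly contained open neighbourhood `Ω'` of `tsupport φ`
    obtain ⟨δ, hδ, hδΩ⟩ := hφ.hasCompactSupport.exists_cthickening_subset_open Ω.isOpen hφ.tsupport_subset
    set Ω' : Opens E := ⟨thickening δ (tsupport φ), isOpen_thickening⟩ with hΩ'def
    have hΩ'K : tsupport φ ⊆ (Ω' : Set E) := self_subset_thickening hδ _
    have hΩ'c : (Ω' : Set E) ⊆ cthickening δ (tsupport φ) := thickening_subset_cthickening δ _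
    have hKc : IsCompact (cthickening δ (tsupport φ)) :=
      isCompact_of_isClosed_isBounded isClosed_cthickening hφ.hasCompactSupport.isBounded.cthickening
    have hΩ'Ω : (Ω' : Set E) ⊆ (Ω : Set E) := hΩ'c.trans hδΩ
    have hΩ'le : Ω' ≤ Ω := hΩ'Ω
    have hΩ'm : MeasurableSet (Ω' : Set E) := Ω'.isOpen.measurableSet
    -- (2) `w ∈ W^{1,1}(Ω')`
    have hw' : HasWeakFDerivOn Ω' μ w Gw := HasWeakFDerivOn.mono_set_holds hw hΩ'le
    have hwI : IntegrableOn w (Ω' : Set E) μ :=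
      (hw.locallyIntegrableOn.integrableOn_compact_subset hδΩ hKc).mono_set hΩ'c
    have hGI : IntegrableOn Gw (Ω' : Set E) μ :=
      (hw.locallyIntegrableOn_deriv.integrableOn_compact_subset hδΩ hKc).mono_set hΩ'c
    have hmem : MemSobolevDomain 1 1 Ω' μ w := by
      rw [memSobolevDomain_succ_iff]
      refine ⟨memLp_one_iff_integrable.mpr hwI, Gw, hw', fun v => ?_⟩
      rw [memSobolevDomain_zero_iff, memLp_one_iff_integrable]
      exact (ContinuousLinearMap.apply ℝ F v).integrable_comp hGI
    -- (3) Meyers–Serrin on `Ω'`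
    obtain ⟨u, hu, hlim⟩ := MeyersSerrin.exists_contDiffOn_tendsto_eSobolevDomainNorm_sub (Ω := Ω') (μ := μ)
      (p := 1) le_rfl ENNReal.one_ne_top hmem
    obtain ⟨hL1, hD1⟩ := tendsto_eLpNorm_of_tendsto_eSobolevDomainNorm hw' hu hlim
    -- (4) the classical identity for `N ∘ u n` on `Ω'`
    have hφ' : IsTestFunctionOn Ω' φ := ⟨hφ.contDiff, hφ.hasCompactSupport, hΩ'K⟩
    have hNu : ∀ n, ContDiffOn ℝ ∞ (fun x => N (u n x)) (Ω' : Set E) := fun n => hN.comp_contDiffOn (hu n)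
    have hNu' : ∀ n x, x ∈ (Ω' : Set E) →
        fderiv ℝ (fun x => N (u n x)) x = (fderiv ℝ N (u n x)).comp (fderiv ℝ (u n) x) := by
      intro n x hx
      have hux : DifferentiableAt ℝ (u n) x :=
        ((hu n).differentiableOn (by simp)).differentiableAt (Ω'.isOpen.mem_nhds hx)
      exact fderiv_comp x (hNd _) hux
    have idn : ∀ n, ∫ x in (Ω' : Set E), (fderiv ℝ φ x v) • N (u n x) ∂μ =
        -∫ x in (Ω' : Set E), φ x • (fderiv ℝ N (u n x)) (fderiv ℝ (u n) x v) ∂μ := by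
      intro n
      have h := (MeyersSerrin.hasWeakFDerivOn_of_contDiffOn (μ := μ) (hNu n)).integral_fderiv_smul_eq φ v hφ'
      rw [h]
      congr 1
      refine setIntegral_congr_fun hΩ'm fun x hx => ?_
      rw [hNu' n x hx, ContinuousLinearMap.comp_apply]
    -- (5) measurability letters on `Ω'`
    have hum : ∀ n, AEStronglyMeasurable (u n) (μ.restrict (Ω' : Set E)) :=
      fun n => ((hu n).continuousOn).aestronglyMeasurable hΩ'm
    have hu'm : ∀ n, AEStronglyMeasurable (fun x => fderiv ℝ (u n) x v) (μ.restrict (Ω' : Set E)) :=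
      fun n => (((hu n).continuousOn_fderiv_of_isOpen Ω'.isOpen (by simp)).clm_apply continuousOn_const)
        |>.aestronglyMeasurable hΩ'm
    have hwm' : AEStronglyMeasurable w (μ.restrict (Ω' : Set E)) := hwI.aestronglyMeasurable
    have hGvI : Integrable (fun x => Gw x v) (μ.restrict (Ω' : Set E)) :=
      (ContinuousLinearMap.apply ℝ F v).integrable_comp hGI
    have hGvm : AEStronglyMeasurable (fun x => Gw x v) (μ.restrict (Ω' : Set E)) := hGvI.aestronglyMeasurable
    have hφc : Continuous φ := hφ.contDiff.continuous
    have hφ'c : Continuous fun x => fderiv ℝ φ x v :=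
      (hφ.contDiff.continuous_fderiv (by simp)).clm_apply continuous_const
    -- applying a measurable operator field to a measurable vector field is measurable
    have happly : ∀ {T : E → F →L[ℝ] F'} {y : E → F},
        AEStronglyMeasurable T (μ.restrict (Ω' : Set E)) → AEStronglyMeasurable y (μ.restrict (Ω' : Set E)) →
        AEStronglyMeasurable (fun x => T x (y x)) (μ.restrict (Ω' : Set E)) := by
      intro T y hT hy
      have := (ContinuousLinearMap.apply ℝ F').aestronglyMeasurable_comp₂ hy hT
      simpa only [ContinuousLinearMap.apply_apply] using this
    have hDNum : ∀ n, AEStronglyMeasurable (fun x => fderiv ℝ N (u n x)) (μ.restrict (Ω' : Set E)) :=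
      fun n => hN'c.comp_aestronglyMeasurable (hum n)
    have hDNwm : AEStronglyMeasurable (fun x => fderiv ℝ N (w x)) (μ.restrict (Ω' : Set E)) :=
      hN'c.comp_aestronglyMeasurable hwm'
    -- (6) an a.e.-convergent subsequence
    have hmeas : TendstoInMeasure (μ.restrict (Ω' : Set E)) u atTop w := by
      refine tendstoInMeasure_of_tendsto_eLpNorm one_ne_zero hum hwm' ?_
      refine (tendsto_congr fun n => ?_).mp hL1
      rw [← eLpNorm_neg]
      congr 1
      funext x
      simp
    obtain ⟨ns, hns, hae⟩ := hmeas.exists_seq_tendsto_ae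
    -- (7) bounds for the test function
    obtain ⟨Mφ, hMφ⟩ := hφ.hasCompactSupport.exists_bound_of_continuous hφc
    obtain ⟨Mφ', hMφ'⟩ := (hφ.hasCompactSupport.fderiv_apply (𝕜 := ℝ) v).exists_bound_of_continuous hφ'c
    have hMφ0 : 0 ≤ Mφ := (norm_nonneg _).trans (hMφ 0)
    have hMφ'0 : 0 ≤ Mφ' := (norm_nonneg _).trans (hMφ' 0)
    -- (8) LHS limit (full sequence): Lipschitz bound
    have lhs_int : ∀ n, Integrable (fun x => (fderiv ℝ φ x v) • N (u n x)) (μ.restrict (Ω' : Set E)) :=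
      fun n => integrableOn_smul_of_locallyIntegrableOn
        (MeyersSerrin.hasWeakFDerivOn_of_contDiffOn (μ := μ) (hNu n)).locallyIntegrableOn hφ'c
        (hφ.hasCompactSupport.fderiv_apply (𝕜 := ℝ) v) ((tsupport_fderiv_apply_subset ℝ v).trans hΩ'K)
    have lhs_lim : Tendsto (fun n => ∫ x in (Ω' : Set E), (fderiv ℝ φ x v) • N (u n x) ∂μ) atTop
        (𝓝 (∫ x in (Ω' : Set E), (fderiv ℝ φ x v) • N (w x) ∂μ)) := by
      refine tendsto_integral_of_L1 _ (hφ'c.aestronglyMeasurable.smul (hNc.comp_aestronglyMeasurable hwm'))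
        (Filter.Eventually.of_forall lhs_int) ?_
      have hb : ∀ n, ∫⁻ x in (Ω' : Set E), ‖(fderiv ℝ φ x v) • N (u n x) - (fderiv ℝ φ x v) • N (w x)‖ₑ ∂μ ≤
          ENNReal.ofReal (Mφ' * C) * eLpNorm (fun x => w x - u n x) 1 (μ.restrict (Ω' : Set E)) := by
        intro n
        rw [eLpNorm_one_eq_lintegral_enorm, ← lintegral_const_mul' _ _ ENNReal.ofReal_ne_top]
        refine lintegral_mono fun x => ?_
        rw [← ofReal_norm, ← ofReal_norm, ← ENNReal.ofReal_mul (by positivity)]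
        refine ENNReal.ofReal_le_ofReal ?_
        have h1 := norm_sub_le_of_fderiv_bounded (E := E) hNd hC (u n x) (w x)
        rw [← smul_sub, norm_smul, norm_sub_rev (w x)]
        calc ‖fderiv ℝ φ x v‖ * ‖N (u n x) - N (w x)‖ ≤ Mφ' * (C * ‖u n x - w x‖) :=
              mul_le_mul (hMφ' x) h1 (norm_nonneg _) hMφ'0
          _ = Mφ' * C * ‖u n x - w x‖ := by ring
      have h0 : Tendsto (fun n => ENNReal.ofReal (Mφ' * C) * eLpNorm (fun x => w x - u n x) 1
          (μ.restrict (Ω' : Set E))) atTop (𝓝 0) := by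
        have := ENNReal.Tendsto.const_mul (a := ENNReal.ofReal (Mφ' * C)) hL1 (Or.inr ENNReal.ofReal_ne_top)
        simpa only [mul_zero] using this
      exact tendsto_of_tendsto_of_tendsto_of_le_of_le tendsto_const_nhds h0 (fun _ => bot_le) hb
    -- (9) RHS limit along the subsequence, in `L¹`
    -- (9a) the `A`-part: `φ • DN(u)(∇u v − Gw v)` is eventually integrable and → 0 in `L¹`
    have hDiffI : ∀ᶠ n in atTop, Integrable (fun x => Gw x v - fderiv ℝ (u n) x v) (μ.restrict (Ω' : Set E)) := by
      have hlt : ∀ᶠ n in atTop, eLpNorm (fun x => Gw x v - fderiv ℝ (u n) x v) 1 (μ.restrict (Ω' : Set E)) < 1 :=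
        (hD1 v).eventually (gt_mem_nhds zero_lt_one)
      filter_upwards [hlt] with n hn
      exact memLp_one_iff_integrable.mp ⟨hGvm.sub (hu'm n), hn.trans ENNReal.one_lt_top⟩
    have hRint : ∀ᶠ n in atTop,
        Integrable (fun x => φ x • (fderiv ℝ N (u n x)) (fderiv ℝ (u n) x v)) (μ.restrict (Ω' : Set E)) := by
      filter_upwards [hDiffI] with n hn
      have hder : Integrable (fun x => fderiv ℝ (u n) x v) (μ.restrict (Ω' : Set E)) := by
        have := hGvI.sub hn
        refine this.congr (Filter.Eventually.of_forall fun x => ?_)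
        simp only [Pi.sub_apply, sub_sub_cancel]
      have hm : AEStronglyMeasurable (fun x => φ x • (fderiv ℝ N (u n x)) (fderiv ℝ (u n) x v))
          (μ.restrict (Ω' : Set E)) := hφc.aestronglyMeasurable.smul (happly (hDNum n) (hu'm n))
      refine Integrable.mono' (hder.norm.const_mul (Mφ * C)) hm (Filter.Eventually.of_forall fun x => ?_)
      rw [norm_smul]
      calc ‖φ x‖ * ‖(fderiv ℝ N (u n x)) (fderiv ℝ (u n) x v)‖ ≤ Mφ * (C * ‖fderiv ℝ (u n) x v‖) :=
            mul_le_mul (hMφ x) ((ContinuousLinearMap.le_opNorm _ _).trans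
              (mul_le_mul_of_nonneg_right (hC _) (norm_nonneg _))) (norm_nonneg _) hMφ0
        _ = Mφ * C * ‖fderiv ℝ (u n) x v‖ := by ring
    -- the `L¹` distance to the limit, bounded by the two parts
    have hsplit : ∀ n x, ‖φ x • (fderiv ℝ N (u n x)) (fderiv ℝ (u n) x v) - φ x • (fderiv ℝ N (w x)) (Gw x v)‖ₑ ≤
        ENNReal.ofReal (Mφ * C) * ‖Gw x v - fderiv ℝ (u n) x v‖ₑ +
          ‖φ x • (fderiv ℝ N (u n x)) (Gw x v) - φ x • (fderiv ℝ N (w x)) (Gw x v)‖ₑ := by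
      intro n x
      have heq : φ x • (fderiv ℝ N (u n x)) (fderiv ℝ (u n) x v) - φ x • (fderiv ℝ N (w x)) (Gw x v) =
          φ x • (fderiv ℝ N (u n x)) (fderiv ℝ (u n) x v - Gw x v) +
            (φ x • (fderiv ℝ N (u n x)) (Gw x v) - φ x • (fderiv ℝ N (w x)) (Gw x v)) := by
        rw [map_sub, smul_sub]; abel
      rw [heq]
      refine (enorm_add_le _ _).trans (add_le_add ?_ le_rfl)
      rw [← ofReal_norm, ← ofReal_norm, ← ENNReal.ofReal_mul (by positivity)]
      refine ENNReal.ofReal_le_ofReal ?_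
      rw [norm_smul, norm_sub_rev (Gw x v)]
      calc ‖φ x‖ * ‖(fderiv ℝ N (u n x)) (fderiv ℝ (u n) x v - Gw x v)‖
          ≤ Mφ * (C * ‖fderiv ℝ (u n) x v - Gw x v‖) :=
            mul_le_mul (hMφ x) ((ContinuousLinearMap.le_opNorm _ _).trans
              (mul_le_mul_of_nonneg_right (hC _) (norm_nonneg _))) (norm_nonneg _) hMφ0
        _ = Mφ * C * ‖fderiv ℝ (u n) x v - Gw x v‖ := by ring
    -- (9b) the `A`-part tends to `0` in `L¹` (full sequence)
    have hA : Tendsto (fun n => ∫⁻ x in (Ω' : Set E), ENNReal.ofReal (Mφ * C) * ‖Gw x v - fderiv ℝ (u n) x v‖ₑ ∂μ)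
        atTop (𝓝 0) := by
      have h1 : ∀ n, ∫⁻ x in (Ω' : Set E), ENNReal.ofReal (Mφ * C) * ‖Gw x v - fderiv ℝ (u n) x v‖ₑ ∂μ =
          ENNReal.ofReal (Mφ * C) * eLpNorm (fun x => Gw x v - fderiv ℝ (u n) x v) 1 (μ.restrict (Ω' : Set E)) := by
        intro n
        rw [eLpNorm_one_eq_lintegral_enorm, lintegral_const_mul' _ _ ENNReal.ofReal_ne_top]
      simp_rw [h1]
      have := ENNReal.Tendsto.const_mul (a := ENNReal.ofReal (Mφ * C)) (hD1 v) (Or.inr ENNReal.ofReal_ne_top)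
      simpa only [mul_zero] using this
    -- (9c) the `B`-part along the subsequence: dominated convergence
    have hB : Tendsto (fun k => ∫⁻ x in (Ω' : Set E),
        ENNReal.ofReal ‖φ x • (fderiv ℝ N (u (ns k) x)) (Gw x v) - φ x • (fderiv ℝ N (w x)) (Gw x v)‖ ∂μ)
        atTop (𝓝 0) := by
      refine tendsto_lintegral_norm_of_dominated_convergence (bound := fun x => Mφ * C * ‖Gw x v‖)
        (fun k => hφc.aestronglyMeasurable.smul (happly (hDNum (ns k)) hGvm))
        ((hGvI.norm.const_mul (Mφ * C)).hasFiniteIntegral) (fun k => Filter.Eventually.of_forall fun x => ?_) ?_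
      · rw [norm_smul]
        calc ‖φ x‖ * ‖(fderiv ℝ N (u (ns k) x)) (Gw x v)‖ ≤ Mφ * (C * ‖Gw x v‖) :=
              mul_le_mul (hMφ x) ((ContinuousLinearMap.le_opNorm _ _).trans
                (mul_le_mul_of_nonneg_right (hC _) (norm_nonneg _))) (norm_nonneg _) hMφ0
          _ = Mφ * C * ‖Gw x v‖ := by ring
      · filter_upwards [hae] with x hx
        have h1 : Tendsto (fun k => fderiv ℝ N (u (ns k) x)) atTop (𝓝 (fderiv ℝ N (w x))) :=
          (hN'c.tendsto _).comp hx
        have h2 : Tendsto (fun k => (fderiv ℝ N (u (ns k) x)) (Gw x v)) atTop (𝓝 ((fderiv ℝ N (w x)) (Gw x v))) :=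
          ((ContinuousLinearMap.apply ℝ F' (Gw x v)).continuous.tendsto _).comp h1
        exact h2.const_smul (φ x)
    -- (9d) `R (ns k) → R` by `L¹` convergence
    have hR_lim : Tendsto (fun k => ∫ x in (Ω' : Set E), φ x • (fderiv ℝ N (u (ns k) x)) (fderiv ℝ (u (ns k)) x v) ∂μ)
        atTop (𝓝 (∫ x in (Ω' : Set E), φ x • (fderiv ℝ N (w x)) (Gw x v) ∂μ)) := by
      refine tendsto_integral_of_L1 _ (hφc.aestronglyMeasurable.smul (happly hDNwm hGvm))
        (hns.tendsto_atTop.eventually hRint) ?_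
      have hA' : Tendsto (fun k => ∫⁻ x in (Ω' : Set E), ENNReal.ofReal (Mφ * C) *
          ‖Gw x v - fderiv ℝ (u (ns k)) x v‖ₑ ∂μ) atTop (𝓝 0) := hA.comp hns.tendsto_atTop
      have hsum : Tendsto (fun k => (∫⁻ x in (Ω' : Set E), ENNReal.ofReal (Mφ * C) *
            ‖Gw x v - fderiv ℝ (u (ns k)) x v‖ₑ ∂μ) +
          ∫⁻ x in (Ω' : Set E), ENNReal.ofReal ‖φ x • (fderiv ℝ N (u (ns k) x)) (Gw x v) -
            φ x • (fderiv ℝ N (w x)) (Gw x v)‖ ∂μ) atTop (𝓝 0) := by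
        have := hA'.add hB
        simpa only [add_zero] using this
      refine tendsto_of_tendsto_of_tendsto_of_le_of_le tendsto_const_nhds hsum (fun _ => bot_le) fun k => ?_
      rw [← lintegral_add_left' ?_]
      · refine lintegral_mono fun x => ?_
        have := hsplit (ns k) x
        rwa [ofReal_norm]
      · exact ((hGvm.sub (hu'm (ns k))).enorm.const_mul _)
    -- (10) identity on `Ω'`
    have hΩ'id : ∫ x in (Ω' : Set E), (fderiv ℝ φ x v) • N (w x) ∂μ =
        -∫ x in (Ω' : Set E), φ x • (fderiv ℝ N (w x)) (Gw x v) ∂μ := by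
      have h1 : Tendsto (fun k => ∫ x in (Ω' : Set E), (fderiv ℝ φ x v) • N (u (ns k) x) ∂μ) atTop
          (𝓝 (∫ x in (Ω' : Set E), (fderiv ℝ φ x v) • N (w x) ∂μ)) := lhs_lim.comp hns.tendsto_atTop
      have h2 : Tendsto (fun k => ∫ x in (Ω' : Set E), (fderiv ℝ φ x v) • N (u (ns k) x) ∂μ) atTop
          (𝓝 (-∫ x in (Ω' : Set E), φ x • (fderiv ℝ N (w x)) (Gw x v) ∂μ)) := by
        have := hR_lim.neg
        refine this.congr fun k => ?_
        exact (idn (ns k)).symm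
      exact tendsto_nhds_unique h1 h2
    -- (11) transfer from `Ω'` to `Ω`
    have hΩm : MeasurableSet (Ω : Set E) := Ω.isOpen.measurableSet
    have hzero : ∀ x, x ∉ (Ω' : Set E) → φ x = 0 := fun x hx =>
      image_eq_zero_of_notMem_tsupport fun h => hx (hΩ'K h)
    have hzero' : ∀ x, x ∉ (Ω' : Set E) → fderiv ℝ φ x v = 0 := fun x hx =>
      image_eq_zero_of_notMem_tsupport (f := fun x => fderiv ℝ φ x v)
        fun h => hx (hΩ'K (tsupport_fderiv_apply_subset ℝ v h))
    rw [setIntegral_eq_of_subset_of_forall_sdiff_eq_zero hΩm hΩ'Ω fun x hx => by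
        rw [hzero' x hx.2, zero_smul],
      setIntegral_eq_of_subset_of_forall_sdiff_eq_zero hΩm hΩ'Ω fun x hx => by
        rw [hzero x hx.2, zero_smul]]
    exact hΩ'id

end Literature.Analysis.PDE.MinimisingMaps

end Part2

/-!
## Part 3 — port of `Summits/QuantumFields/YangMills/Theorems/PoincareLipschitzSobolevChainRuleByApproximation.lean` (4 declarations kept)

# Energy minimising maps into `S³` (Hardt–Kinderlehrer–Lin / Luckhaus / Simon §2.9): Sobolev Chain Rule By Approximation

Declarations of this Part (verbatim port; each keeps its own docstring and citation): `tendsto_of_eventually_eq`, `aestronglyMeasurable_clm_apply`, `hasWeakFDerivOn_comp_of_eventuallyEq_approx`, `sum_norm_sq_comp_apply_le`.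

Reference keys (see `references.bib` and the declarations' citations): [EvansGariepy1992], [Ziemer1989], [HardtKinderlehrerLin1986].
-/

section Part3

open _root_.MeasureTheory _root_.Set _root_.Function _root_.Filter _root_.Topology _root_.Metric _root_.TopologicalSpace
open scoped _root_.ContDiff _root_.ENNReal _root_.BigOperators

namespace Literature.Analysis.PDE.MinimisingMaps

open Literature.Analysis.FunctionSpaces

variable {E : Type*} [NormedAddCommGroup E] [InnerProductSpace ℝ E] [FiniteDimensional ℝ E]
  [MeasurableSpace E] [BorelSpace E] {μ : Measure E} [μ.IsAddHaarMeasure]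
variable {F : Type*} [NormedAddCommGroup F] [NormedSpace ℝ F] [CompleteSpace F]
variable {F' : Type*} [NormedAddCommGroup F'] [NormedSpace ℝ F']

/-! ## §1 Letters -/

omit [InnerProductSpace ℝ E] [FiniteDimensional ℝ E] [MeasurableSpace E] [BorelSpace E] [CompleteSpace F] in
/-- An eventually constant sequence converges. [cite: EvansGariepy1992, §4.2.2 Thm 4 (ii); Ziemer1989, Thm 2.1.11] -/
theorem tendsto_of_eventually_eq {X : Type*} [TopologicalSpace X] {a : ℕ → X} {b : X}
    (h : ∀ᶠ n in atTop, a n = b) : Tendsto a atTop (𝓝 b) :=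
  (tendsto_const_nhds (x := b)).congr' (h.mono fun _ hn => hn.symm)

omit [NormedAddCommGroup E] [InnerProductSpace ℝ E] [FiniteDimensional ℝ E] [BorelSpace E] [CompleteSpace F] in
/-- Applying a measurable operator field to a measurable vector field is measurable. [cite: EvansGariepy1992, §4.2.2 Thm 4 (ii); Ziemer1989, Thm 2.1.11] -/
theorem aestronglyMeasurable_clm_apply {ν : Measure E} {T : E → F →L[ℝ] F'} {y : E → F}
    (hT : AEStronglyMeasurable T ν) (hy : AEStronglyMeasurable y ν) :
    AEStronglyMeasurable (fun x => T x (y x)) ν := by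
  have := (ContinuousLinearMap.apply ℝ F').aestronglyMeasurable_comp₂ hy hT
  simpa only [ContinuousLinearMap.apply_apply] using this

/-! ## §2 The chain rule by eventually-constant smooth approximation -/

/-- **WEAK CHAIN RULE BY SMOOTH APPROXIMATION OF THE OUTER MAP.**  Let `w` be weakly differentiable on `Ω` with weak gradient
`Gw`, and let `P : F → F′` be the pointwise EVENTUALLY-CONSTANT limit of smooth maps `N n` with globally bounded derivatives
(`‖D(N n)‖ ≤ C_n`), uniformly bounded values `‖N n y‖ ≤ B`, derivatives eventually equal to `fderiv ℝ P` pointwise, and a common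
majorant `‖D(N n) y‖ ≤ M y` with `x ↦ M (w x)·‖Gw x‖` locally integrable on `Ω`.  Then `P ∘ w` is weakly differentiable on `Ω` with
weak gradient `x ↦ D P(w x) ∘ Gw x` (the nonlinear chain rule `hasWeakFDerivOn_comp_of_fderiv_bounded` for each `N n ∘ w`, then
dominated convergence on both sides of the test identity).  Typical use: `P` = the Hardt–Kinderlehrer–Lin ray projection `π_p`
(singular at `p`, junk values `π_p p = p`, `fderiv ℝ π_p p = 0`), `N n ≡ p` near `p`, `M y = K∕‖y − p‖`. [cite: EvansGariepy1992, §4.2.2 Thm 4 (ii); Ziemer1989, Thm 2.1.11] -/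
theorem hasWeakFDerivOn_comp_of_eventuallyEq_approx {Ω : Opens E} {w : E → F} {Gw : E → E →L[ℝ] F}
    (hw : HasWeakFDerivOn Ω μ w Gw) {P : F → F'} {N : ℕ → F → F'} (hN : ∀ n, ContDiff ℝ ∞ (N n))
    (hNC : ∀ n, ∃ C : ℝ, ∀ y, ‖fderiv ℝ (N n) y‖ ≤ C) {B : ℝ} (hNB : ∀ n y, ‖N n y‖ ≤ B)
    (hNP : ∀ y, ∀ᶠ n in atTop, N n y = P y) (hNP' : ∀ y, ∀ᶠ n in atTop, fderiv ℝ (N n) y = fderiv ℝ P y)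
    {M : F → ℝ} (hM : ∀ n y, ‖fderiv ℝ (N n) y‖ ≤ M y)
    (hInt : LocallyIntegrableOn (fun x => M (w x) * ‖Gw x‖) (Ω : Set E) μ) :
    HasWeakFDerivOn Ω μ (fun x => P (w x)) (fun x => (fderiv ℝ P (w x)).comp (Gw x)) := by
  have hΩlc : IsLocallyClosed (Ω : Set E) := Ω.isOpen.isLocallyClosed
  -- each `N n ∘ w` is weakly differentiable (the nonlinear chain rule)
  have hn : ∀ n, HasWeakFDerivOn Ω μ (fun x => N n (w x)) (fun x => (fderiv ℝ (N n) (w x)).comp (Gw x)) := by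
    intro n
    obtain ⟨C, hC⟩ := hNC n
    exact hasWeakFDerivOn_comp_of_fderiv_bounded hw (hN n) hC
  -- limits of the bounds
  have hPB : ∀ y, ‖P y‖ ≤ B := fun y => by
    obtain ⟨n, hn'⟩ := (hNP y).exists
    rw [← hn']; exact hNB n y
  have hPM : ∀ y, ‖fderiv ℝ P y‖ ≤ M y := fun y => by
    obtain ⟨n, hn'⟩ := (hNP' y).exists
    rw [← hn']; exact hM n y
  -- pointwise (everywhere) convergence of values and gradients
  have hlimP : ∀ x, Tendsto (fun n => N n (w x)) atTop (𝓝 (P (w x))) := fun x => tendsto_of_eventually_eq (hNP (w x))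
  have hlimD : ∀ x (e : E), Tendsto (fun n => ((fderiv ℝ (N n) (w x)).comp (Gw x)) e) atTop
      (𝓝 (((fderiv ℝ P (w x)).comp (Gw x)) e)) := fun x e => by
    refine tendsto_of_eventually_eq ((hNP' (w x)).mono fun n hn' => ?_)
    simp only [ContinuousLinearMap.comp_apply, hn']
  have hlimD' : ∀ x, Tendsto (fun n => (fderiv ℝ (N n) (w x)).comp (Gw x)) atTop
      (𝓝 ((fderiv ℝ P (w x)).comp (Gw x))) := fun x =>
    tendsto_of_eventually_eq ((hNP' (w x)).mono fun n hn' => by rw [hn'])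
  -- measurability of the limits on `Ω`
  have hmP : AEStronglyMeasurable (fun x => P (w x)) (μ.restrict Ω) :=
    aestronglyMeasurable_of_tendsto_ae atTop (fun n => (hn n).locallyIntegrableOn.aestronglyMeasurable)
      (Eventually.of_forall hlimP)
  have hmH : AEStronglyMeasurable (fun x => (fderiv ℝ P (w x)).comp (Gw x)) (μ.restrict Ω) :=
    aestronglyMeasurable_of_tendsto_ae atTop (fun n => (hn n).locallyIntegrableOn_deriv.aestronglyMeasurable)
      (Eventually.of_forall hlimD')
  refine ⟨?_, ?_, fun φ v hφ => ?_⟩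
  · -- local integrability of `P ∘ w` (bounded and measurable)
    rw [locallyIntegrableOn_iff hΩlc]
    intro K hK hKc
    refine Integrable.mono' (integrableOn_const (C := B) (hKc.measure_lt_top (μ := μ)).ne) (hmP.mono_measure
      (Measure.restrict_mono hK le_rfl)) (Eventually.of_forall fun x => hPB _)
  · -- local integrability of the gradient (dominated by `M(w)·‖Gw‖`)
    rw [locallyIntegrableOn_iff hΩlc]
    intro K hK hKc
    have hIK : IntegrableOn (fun x => M (w x) * ‖Gw x‖) K μ := hInt.integrableOn_compact_subset hK hKc
    refine Integrable.mono' hIK (hmH.mono_measure (Measure.restrict_mono hK le_rfl)) (Eventually.of_forall fun x => ?_)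
    exact (ContinuousLinearMap.opNorm_comp_le _ _).trans (mul_le_mul_of_nonneg_right (hPM _) (norm_nonneg _))
  · -- the test identity, by dominated convergence on both sides
    have hφc : Continuous φ := hφ.contDiff.continuous
    have hφ'c : Continuous fun x => fderiv ℝ φ x v := (hφ.contDiff.continuous_fderiv (by simp)).clm_apply continuous_const
    have hφ's : HasCompactSupport fun x => fderiv ℝ φ x v := hφ.hasCompactSupport.fderiv_apply (𝕜 := ℝ) v
    have idn : ∀ n, ∫ x in (Ω : Set E), (fderiv ℝ φ x v) • N n (w x) ∂μ =
        -∫ x in (Ω : Set E), φ x • ((fderiv ℝ (N n) (w x)).comp (Gw x)) v ∂μ :=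
      fun n => (hn n).integral_fderiv_smul_eq φ v hφ
    -- LHS → by dominated convergence (bound `‖∂ᵥφ‖·B`)
    have hL : Tendsto (fun n => ∫ x in (Ω : Set E), (fderiv ℝ φ x v) • N n (w x) ∂μ) atTop
        (𝓝 (∫ x in (Ω : Set E), (fderiv ℝ φ x v) • P (w x) ∂μ)) := by
      refine tendsto_integral_of_dominated_convergence (fun x => ‖fderiv ℝ φ x v‖ * B) ?_ ?_ ?_ ?_
      · intro n
        exact hφ'c.aestronglyMeasurable.smul (hn n).locallyIntegrableOn.aestronglyMeasurable
      · exact ((hφ'c.norm.mul continuous_const).integrable_of_hasCompactSupport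
          (hφ's.norm.mul_right)).integrableOn
      · intro n
        refine Eventually.of_forall fun x => ?_
        rw [norm_smul]
        exact mul_le_mul_of_nonneg_left (hNB n _) (norm_nonneg _)
      · exact Eventually.of_forall fun x => (hlimP x).const_smul _
    -- RHS → by dominated convergence (bound `‖φ‖·M(w)‖Gw‖‖v‖`, integrable on `Ω` because `tsupport φ ⊆ Ω` is compact)
    have hsupp : tsupport (fun x => ‖φ x‖ * ‖v‖) ⊆ (Ω : Set E) := by
      refine (closure_mono ?_).trans hφ.tsupport_subset
      intro x hx
      simp only [Function.mem_support, ne_eq, mul_eq_zero, norm_eq_zero, not_or] at hx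
      exact hx.1
    have hbound : IntegrableOn (fun x => (‖φ x‖ * ‖v‖) • (M (w x) * ‖Gw x‖)) (Ω : Set E) μ :=
      integrableOn_smul_of_locallyIntegrableOn hInt (hφc.norm.mul continuous_const)
        (hφ.hasCompactSupport.norm.mul_right) hsupp
    have hR : Tendsto (fun n => ∫ x in (Ω : Set E), φ x • ((fderiv ℝ (N n) (w x)).comp (Gw x)) v ∂μ) atTop
        (𝓝 (∫ x in (Ω : Set E), φ x • ((fderiv ℝ P (w x)).comp (Gw x)) v ∂μ)) := by
      refine tendsto_integral_of_dominated_convergence (fun x => (‖φ x‖ * ‖v‖) • (M (w x) * ‖Gw x‖)) ?_ hbound ?_ ?_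
      · intro n
        exact hφc.aestronglyMeasurable.smul
          (aestronglyMeasurable_clm_apply (hn n).locallyIntegrableOn_deriv.aestronglyMeasurable aestronglyMeasurable_const)
      · intro n
        refine Eventually.of_forall fun x => ?_
        rw [norm_smul, smul_eq_mul]
        have h1 : ‖((fderiv ℝ (N n) (w x)).comp (Gw x)) v‖ ≤ M (w x) * ‖Gw x‖ * ‖v‖ :=
          calc ‖((fderiv ℝ (N n) (w x)).comp (Gw x)) v‖ ≤ ‖(fderiv ℝ (N n) (w x)).comp (Gw x)‖ * ‖v‖ :=
                ContinuousLinearMap.le_opNorm _ _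
            _ ≤ ‖fderiv ℝ (N n) (w x)‖ * ‖Gw x‖ * ‖v‖ :=
                mul_le_mul_of_nonneg_right (ContinuousLinearMap.opNorm_comp_le _ _) (norm_nonneg _)
            _ ≤ M (w x) * ‖Gw x‖ * ‖v‖ := by
                refine mul_le_mul_of_nonneg_right ?_ (norm_nonneg _)
                exact mul_le_mul_of_nonneg_right (hM n _) (norm_nonneg _)
        calc ‖φ x‖ * ‖((fderiv ℝ (N n) (w x)).comp (Gw x)) v‖ ≤ ‖φ x‖ * (M (w x) * ‖Gw x‖ * ‖v‖) :=
              mul_le_mul_of_nonneg_left h1 (norm_nonneg _)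
          _ = ‖φ x‖ * ‖v‖ * (M (w x) * ‖Gw x‖) := by ring
      · exact Eventually.of_forall fun x => (hlimD x v).const_smul _
    have hR' := hR.neg
    have heq : (fun n => ∫ x in (Ω : Set E), (fderiv ℝ φ x v) • N n (w x) ∂μ) =
        fun n => -∫ x in (Ω : Set E), φ x • ((fderiv ℝ (N n) (w x)).comp (Gw x)) v ∂μ := funext idn
    rw [heq] at hL
    exact tendsto_nhds_unique hL hR'

/-! ## §3 The density row -/

omit [FiniteDimensional ℝ E] [MeasurableSpace E] [BorelSpace E] [CompleteSpace F] in
/-- **DENSITY OF THE COMPOSED GRADIENT.**  `Σᵢ‖(DP(w x) ∘ Gw x) eᵢ‖² ≤ (M′(w x))²·Σᵢ‖Gw x eᵢ‖²` whenever `‖DP y‖ ≤ M′ y`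
(any finite index family of directions). [cite: EvansGariepy1992, §4.2.2 Thm 4 (ii); Ziemer1989, Thm 2.1.11] -/
theorem sum_norm_sq_comp_apply_le {ι : Type*} (s : Finset ι) (e : ι → E) {w : E → F} {Gw : E → E →L[ℝ] F} {P : F → F'}
    {M' : F → ℝ} (hM' : ∀ y, ‖fderiv ℝ P y‖ ≤ M' y) (x : E) :
    ∑ i ∈ s, ‖((fderiv ℝ P (w x)).comp (Gw x)) (e i)‖ ^ 2 ≤ (M' (w x)) ^ 2 * ∑ i ∈ s, ‖Gw x (e i)‖ ^ 2 := by
  have hM0 : 0 ≤ M' (w x) := (norm_nonneg _).trans (hM' _)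
  rw [Finset.mul_sum]
  refine Finset.sum_le_sum fun i _ => ?_
  have h1 : ‖((fderiv ℝ P (w x)).comp (Gw x)) (e i)‖ ≤ M' (w x) * ‖Gw x (e i)‖ := by
    rw [ContinuousLinearMap.comp_apply]
    exact ((fderiv ℝ P (w x)).le_opNorm _).trans (mul_le_mul_of_nonneg_right (hM' _) (norm_nonneg _))
  calc ‖((fderiv ℝ P (w x)).comp (Gw x)) (e i)‖ ^ 2 ≤ (M' (w x) * ‖Gw x (e i)‖) ^ 2 :=
        pow_le_pow_left₀ (norm_nonneg _) h1 2
    _ = (M' (w x)) ^ 2 * ‖Gw x (e i)‖ ^ 2 := by ring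

end Literature.Analysis.PDE.MinimisingMaps

end Part3

/-!
## Part 4 — port of `Summits/QuantumFields/YangMills/Theorems/PoincareLipschitzSphereRayProjectionCalculus.lean` (21 declarations kept)

# Energy minimising maps into `S³` (Hardt–Kinderlehrer–Lin / Luckhaus / Simon §2.9): Sphere Ray Projection Calculus

Declarations of this Part (verbatim port; each keeps its own docstring and citation): `rayProj_self`, `norm_rayProj_sub_centre_le`, `contDiffAt_rayProj_sub_centre`, `norm_fderiv_rayProj_le`, `not_continuousAt_rayProj`, `fderiv_rayProj_centre`, `exists_lipschitz_smoothTransition`, `norm_root_smul_dir_le`, `smoothRayProj_eq_centre`, `smoothRayProj_eq_rayProj`, `norm_smoothRayProj_le`, `smoothRayProj_eventuallyEq_const`, `smoothRayProj_eventuallyEq_rayProj`, `contDiff_smoothRayProj`, `fderiv_smoothRayProj_eq_zero`, `fderiv_smoothRayProj_eq_fderiv_rayProj`, `exists_norm_fderiv_smoothRayProj_le`, `exists_norm_fderiv_smoothRayProj_le_const`, `eventually_two_mul_sq_inv_succ_lt`, `eventually_smoothRayProj_eq`, `eventually_fderiv_smoothRayProj_eq`.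

Reference keys (see `references.bib` and the declarations' citations): [HardtKinderlehrerLin1986].
-/

section Part4

open scoped _root_.InnerProductSpace _root_.ContDiff _root_.Topology
open RealInnerProductSpace _root_.Filter _root_.Metric _root_.Set

namespace Literature.Analysis.PDE.MinimisingMaps

variable {V : Type*} [NormedAddCommGroup V] [InnerProductSpace ℝ V]

/-! ## §1 The ray projection `π_p`: value at the centre, bounds, smoothness off the centre, the derivative bound -/

/-- `π_p p = p`: with `‖0‖⁻¹ = 0` the direction `e_p` is `0`. [cite: HardtKinderlehrerLin1986, §2] -/
theorem rayProj_self (p : V) :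
    p + (-⟪p, ‖p - p‖⁻¹ • (p - p)⟫ + Real.sqrt (⟪p, ‖p - p‖⁻¹ • (p - p)⟫ ^ 2 + (1 - ‖p‖ ^ 2))) •
        (‖p - p‖⁻¹ • (p - p)) = p := by
  simp

/-- `‖π_p y − p‖ ≤ 2` for `‖p‖ ≤ ½` (the root is in `[0,2]` on unit directions; at `y = p` the difference is `0`).
[cite: HardtKinderlehrerLin1986, §2] -/
theorem norm_rayProj_sub_centre_le (p y : V) (hp : ‖p‖ ≤ 1 / 2) :
    ‖(p + (-⟪p, ‖y - p‖⁻¹ • (y - p)⟫ + Real.sqrt (⟪p, ‖y - p‖⁻¹ • (y - p)⟫ ^ 2 + (1 - ‖p‖ ^ 2))) •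
        (‖y - p‖⁻¹ • (y - p))) - p‖ ≤ 2 := by
  by_cases hy : y = p
  · subst hy; simp
  have hyp : y - p ≠ 0 := sub_ne_zero.mpr hy
  have he : ‖‖y - p‖⁻¹ • (y - p)‖ = 1 := by
    rw [norm_smul, Real.norm_eq_abs, abs_of_pos (inv_pos.mpr (norm_pos_iff.mpr hyp)),
      inv_mul_cancel₀ (norm_ne_zero_iff.mpr hyp)]
  rw [add_sub_cancel_left, norm_smul, Real.norm_eq_abs, abs_of_nonneg (root_nonneg p _ (hp.trans (by norm_num))), he, mul_one]
  exact root_le_two p _ hp he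

/-- The `s(p,e_y)•e_y` part of `π_p` (= `π_p y − p`) is `C^∞` at every `y ≠ p` (`‖p‖ ≤ ½`). [cite: HardtKinderlehrerLin1986, §2] -/
theorem contDiffAt_rayProj_sub_centre (p y : V) (hp : ‖p‖ ≤ 1 / 2) (hy : y ≠ p) {n : WithTop ℕ∞} :
    ContDiffAt ℝ n (fun y : V => (-⟪p, ‖y - p‖⁻¹ • (y - p)⟫ + Real.sqrt (⟪p, ‖y - p‖⁻¹ • (y - p)⟫ ^ 2 + (1 - ‖p‖ ^ 2))) • (‖y - p‖⁻¹ • (y - p))) y := by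
  have hyp : y - p ≠ 0 := sub_ne_zero.mpr hy
  have hsub : ContDiffAt ℝ n (fun y : V => y - p) y := contDiffAt_id.sub contDiffAt_const
  have hnorm : ContDiffAt ℝ n (fun y : V => ‖y - p‖) y := hsub.norm ℝ hyp
  have hinv : ContDiffAt ℝ n (fun y : V => ‖y - p‖⁻¹) y := hnorm.inv (norm_ne_zero_iff.mpr hyp)
  have he : ContDiffAt ℝ n (fun y : V => ‖y - p‖⁻¹ • (y - p)) y := hinv.smul hsub
  have hin : ContDiffAt ℝ n (fun y : V => ⟪p, ‖y - p‖⁻¹ • (y - p)⟫) y := contDiffAt_const.inner ℝ he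
  have hpos : ⟪p, ‖y - p‖⁻¹ • (y - p)⟫ ^ 2 + (1 - ‖p‖ ^ 2) ≠ 0 := by
    have : (0:ℝ) < 1 - ‖p‖ ^ 2 := by nlinarith [norm_nonneg p]
    positivity
  have hsq : ContDiffAt ℝ n (fun y : V => Real.sqrt (⟪p, ‖y - p‖⁻¹ • (y - p)⟫ ^ 2 + (1 - ‖p‖ ^ 2))) y :=
    ((hin.pow 2).add contDiffAt_const).sqrt hpos
  exact (hin.neg.add hsq).smul he

/-- **THE KERNEL BOUND `‖Dπ_p(y)‖ ≤ 6∕‖y − p‖`** (`‖p‖ ≤ ½`, `y ≠ p`): H-1's finite-difference Lipschitz bound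
`‖π_p y − π_p z‖ ≤ 6‖y − z‖∕‖y − p‖` on the neighbourhood `{z ≠ p}` of `y`, read by `norm_fderiv_le_of_lip'`. [cite: HardtKinderlehrerLin1986, §2] -/
theorem norm_fderiv_rayProj_le (p y : V) (hp : ‖p‖ ≤ 1 / 2) (hy : y ≠ p) :
    ‖fderiv ℝ (fun y : V => p + (-⟪p, ‖y - p‖⁻¹ • (y - p)⟫ +
        Real.sqrt (⟪p, ‖y - p‖⁻¹ • (y - p)⟫ ^ 2 + (1 - ‖p‖ ^ 2))) • (‖y - p‖⁻¹ • (y - p))) y‖ ≤ 6 / ‖y - p‖ := by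
  have hyp0 : 0 < ‖y - p‖ := norm_pos_iff.mpr (sub_ne_zero.mpr hy)
  refine norm_fderiv_le_of_lip' ℝ (by positivity) ?_
  filter_upwards [isOpen_compl_singleton.mem_nhds hy] with z hz
  have h := norm_rayProj_sub_rayProj_le p y z hp hy hz
  rw [norm_sub_rev] at h
  calc _ ≤ 6 * ‖y - z‖ / ‖y - p‖ := h
    _ = 6 / ‖y - p‖ * ‖z - y‖ := by rw [norm_sub_rev y z]; ring

/-- `π_p` is NOT continuous at the centre (`‖p‖ ≤ ½`, `V` nontrivial): along the ray `p + t•u` (`t > 0`, `‖u‖ = 1`) it is the constant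
`p + s(p,u)•u ≠ p = π_p p`. [cite: HardtKinderlehrerLin1986, §2] -/
theorem not_continuousAt_rayProj (p : V) (hp : ‖p‖ ≤ 1 / 2) {u : V} (hu : ‖u‖ = 1) :
    ¬ ContinuousAt (fun y : V => p + (-⟪p, ‖y - p‖⁻¹ • (y - p)⟫ +
        Real.sqrt (⟪p, ‖y - p‖⁻¹ • (y - p)⟫ ^ 2 + (1 - ‖p‖ ^ 2))) • (‖y - p‖⁻¹ • (y - p))) p := by
  intro hc
  set f : V → V := fun y : V => p + (-⟪p, ‖y - p‖⁻¹ • (y - p)⟫ +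
        Real.sqrt (⟪p, ‖y - p‖⁻¹ • (y - p)⟫ ^ 2 + (1 - ‖p‖ ^ 2))) • (‖y - p‖⁻¹ • (y - p)) with hf
  set c : V := p + (-⟪p, u⟫ + Real.sqrt (⟪p, u⟫ ^ 2 + (1 - ‖p‖ ^ 2))) • u with hcdef
  -- along the ray the map is constant `= c`
  have hray : ∀ t : ℝ, 0 < t → f (p + t • u) = c := by
    intro t ht
    have h1 : p + t • u - p = t • u := add_sub_cancel_left p (t • u)
    have hn : ‖t • u‖ = t := by rw [norm_smul, Real.norm_eq_abs, abs_of_pos ht, hu, mul_one]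
    have he : ‖t • u‖⁻¹ • (t • u) = u := by rw [hn, smul_smul, inv_mul_cancel₀ ht.ne', one_smul]
    simp only [hf, h1, he, hcdef]
  -- the limit along `t → 0⁺` of `f (p + t•u)` is `f p = p` by continuity, and `c` by constancy
  have hpath : Tendsto (fun t : ℝ => p + t • u) (𝓝[>] 0) (𝓝 p) := by
    have : Tendsto (fun t : ℝ => p + t • u) (𝓝 0) (𝓝 (p + (0:ℝ) • u)) :=
      ((continuous_const.add (continuous_id.smul continuous_const)).tendsto 0)
    rw [zero_smul, add_zero] at this
    exact this.mono_left nhdsWithin_le_nhds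
  have hlim1 : Tendsto (fun t : ℝ => f (p + t • u)) (𝓝[>] 0) (𝓝 (f p)) := hc.tendsto.comp hpath
  have hlim2 : Tendsto (fun t : ℝ => f (p + t • u)) (𝓝[>] 0) (𝓝 c) := by
    refine (tendsto_congr' ?_).mpr tendsto_const_nhds
    filter_upwards [self_mem_nhdsWithin] with t ht
    exact hray t ht
  have hfp : f p = p := by rw [hf]; exact rayProj_self p
  have hcp : c = p := by
    have := tendsto_nhds_unique hlim2 hlim1
    rw [this, hfp]
  -- but `‖c‖ = 1 > ½ ≥ ‖p‖`
  have hc1 : ‖c‖ = 1 := by rw [hcdef]; exact norm_add_root_smul_eq_one p u (hp.trans (by norm_num)) hu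
  rw [hcp] at hc1
  linarith

/-- `fderiv ℝ π_p p = 0`: `π_p` is not differentiable at the centre (not even continuous, when `V ≠ 0`), so Mathlib's `fderiv` takes its junk
value `0`; in the trivial space every linear map is `0`. [cite: HardtKinderlehrerLin1986, §2] -/
theorem fderiv_rayProj_centre (p : V) (hp : ‖p‖ ≤ 1 / 2) :
    fderiv ℝ (fun y : V => p + (-⟪p, ‖y - p‖⁻¹ • (y - p)⟫ +
        Real.sqrt (⟪p, ‖y - p‖⁻¹ • (y - p)⟫ ^ 2 + (1 - ‖p‖ ^ 2))) • (‖y - p‖⁻¹ • (y - p))) p = 0 := by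
  by_cases hV : ∃ v : V, v ≠ 0
  · obtain ⟨v, hv⟩ := hV
    have hu : ‖‖v‖⁻¹ • v‖ = 1 := by
      rw [norm_smul, Real.norm_eq_abs, abs_of_pos (inv_pos.mpr (norm_pos_iff.mpr hv)),
        inv_mul_cancel₀ (norm_ne_zero_iff.mpr hv)]
    refine fderiv_zero_of_not_differentiableAt fun hd => ?_
    exact not_continuousAt_rayProj p hp hu hd.continuousAt
  · simp only [ne_eq, not_exists, not_not] at hV
    ext w
    rw [hV w]
    simp

/-! ## §2 A Lipschitz constant for `Real.smoothTransition` -/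

/-- `Real.smoothTransition` is Lipschitz: its derivative is continuous, vanishes off `[0,1]`, hence is bounded. [cite: HardtKinderlehrerLin1986, §2] -/
theorem exists_lipschitz_smoothTransition :
    ∃ L : ℝ, 0 ≤ L ∧ ∀ a b : ℝ, |Real.smoothTransition a - Real.smoothTransition b| ≤ L * |a - b| := by
  have hcd : ContDiff ℝ 1 Real.smoothTransition := Real.smoothTransition.contDiff (n := 1)
  have hd : Differentiable ℝ Real.smoothTransition := hcd.differentiable (by simp)
  have hcont : Continuous (deriv Real.smoothTransition) := hcd.continuous_deriv le_rfl
  obtain ⟨M, hM⟩ := isCompact_Icc.exists_bound_of_continuousOn (hcont.continuousOn (s := Icc (0:ℝ) 1))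
  have hbound : ∀ x : ℝ, ‖deriv Real.smoothTransition x‖ ≤ max M 0 := by
    intro x
    by_cases h0 : x < 0
    · have heq : Real.smoothTransition =ᶠ[𝓝 x] fun _ => (0:ℝ) := by
        filter_upwards [Iio_mem_nhds h0] with z hz using Real.smoothTransition.zero_of_nonpos hz.le
      rw [heq.deriv_eq, deriv_const, norm_zero]; exact le_max_right _ _
    by_cases h1 : 1 < x
    · have heq : Real.smoothTransition =ᶠ[𝓝 x] fun _ => (1:ℝ) := by
        filter_upwards [Ioi_mem_nhds h1] with z hz using Real.smoothTransition.one_of_one_le hz.le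
      rw [heq.deriv_eq, deriv_const, norm_zero]; exact le_max_right _ _
    · exact (hM x ⟨not_lt.mp h0, not_lt.mp h1⟩).trans (le_max_left _ _)
  have hlip : LipschitzWith (max M 0).toNNReal Real.smoothTransition := by
    refine lipschitzWith_of_nnnorm_deriv_le hd fun x => ?_
    rw [← NNReal.coe_le_coe, coe_nnnorm, Real.coe_toNNReal _ (le_max_right _ _)]
    exact hbound x
  refine ⟨max M 0, le_max_right _ _, fun a b => ?_⟩
  have h := hlip.dist_le_mul a b
  rw [Real.dist_eq, Real.dist_eq, Real.coe_toNNReal _ (le_max_right _ _)] at h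
  exact h

/-! ## §3 The regularised family `N_ε y = p + σ(‖y − p‖²∕ε² − 1)•(π_p y − p)` -/

/-- `‖π_p y − p‖ = ‖s(p,e_y)•e_y‖ ≤ 2` (`‖p‖ ≤ ½`). [cite: HardtKinderlehrerLin1986, §2] -/
theorem norm_root_smul_dir_le (p y : V) (hp : ‖p‖ ≤ 1 / 2) :
    ‖(-⟪p, ‖y - p‖⁻¹ • (y - p)⟫ + Real.sqrt (⟪p, ‖y - p‖⁻¹ • (y - p)⟫ ^ 2 + (1 - ‖p‖ ^ 2))) • (‖y - p‖⁻¹ • (y - p))‖ ≤ 2 := by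
  have h := norm_rayProj_sub_centre_le p y hp
  rwa [add_sub_cancel_left] at h

/-- `N_ε y = p` on the closed ball `‖y − p‖ ≤ ε` (there `‖y − p‖²∕ε² − 1 ≤ 0`, so `σ = 0`). [cite: HardtKinderlehrerLin1986, §2] -/
theorem smoothRayProj_eq_centre (p y : V) {ε : ℝ} (hε : 0 < ε) (h : ‖y - p‖ ≤ ε) :
    p + Real.smoothTransition (‖y - p‖ ^ 2 / ε ^ 2 - 1) • ((-⟪p, ‖y - p‖⁻¹ • (y - p)⟫ + Real.sqrt (⟪p, ‖y - p‖⁻¹ • (y - p)⟫ ^ 2 + (1 - ‖p‖ ^ 2))) • (‖y - p‖⁻¹ • (y - p))) = p := by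
  have hx : ‖y - p‖ ^ 2 / ε ^ 2 - 1 ≤ 0 := by
    rw [sub_nonpos, div_le_one (by positivity)]
    exact pow_le_pow_left₀ (norm_nonneg _) h 2
  rw [Real.smoothTransition.zero_of_nonpos hx, zero_smul, add_zero]

/-- `N_ε y = π_p y` off the ball `‖y − p‖² ≥ 2ε²` (there `‖y − p‖²∕ε² − 1 ≥ 1`, so `σ = 1`). [cite: HardtKinderlehrerLin1986, §2] -/
theorem smoothRayProj_eq_rayProj (p y : V) {ε : ℝ} (hε : 0 < ε) (h : 2 * ε ^ 2 ≤ ‖y - p‖ ^ 2) :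
    p + Real.smoothTransition (‖y - p‖ ^ 2 / ε ^ 2 - 1) • ((-⟪p, ‖y - p‖⁻¹ • (y - p)⟫ + Real.sqrt (⟪p, ‖y - p‖⁻¹ • (y - p)⟫ ^ 2 + (1 - ‖p‖ ^ 2))) • (‖y - p‖⁻¹ • (y - p))) = p + (-⟪p, ‖y - p‖⁻¹ • (y - p)⟫ + Real.sqrt (⟪p, ‖y - p‖⁻¹ • (y - p)⟫ ^ 2 + (1 - ‖p‖ ^ 2))) • (‖y - p‖⁻¹ • (y - p)) := by
  have hx : 1 ≤ ‖y - p‖ ^ 2 / ε ^ 2 - 1 := by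
    rw [le_sub_iff_add_le, le_div_iff₀ (by positivity)]
    linarith
  rw [Real.smoothTransition.one_of_one_le hx, one_smul]

/-- THE UNIFORM VALUE BOUND `‖N_ε y‖ ≤ 3` (`‖p‖ ≤ ½`, any `ε`, any `y`): `‖p‖ + σ·‖π_p y − p‖ ≤ ½ + 2`. [cite: HardtKinderlehrerLin1986, §2] -/
theorem norm_smoothRayProj_le (p y : V) (hp : ‖p‖ ≤ 1 / 2) (ε : ℝ) :
    ‖p + Real.smoothTransition (‖y - p‖ ^ 2 / ε ^ 2 - 1) • ((-⟪p, ‖y - p‖⁻¹ • (y - p)⟫ + Real.sqrt (⟪p, ‖y - p‖⁻¹ • (y - p)⟫ ^ 2 + (1 - ‖p‖ ^ 2))) • (‖y - p‖⁻¹ • (y - p)))‖ ≤ 3 := by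
  have hg := norm_root_smul_dir_le p y hp
  have hσ0 := Real.smoothTransition.nonneg (‖y - p‖ ^ 2 / ε ^ 2 - 1)
  have hσ1 := Real.smoothTransition.le_one (‖y - p‖ ^ 2 / ε ^ 2 - 1)
  calc _ ≤ ‖p‖ + ‖Real.smoothTransition (‖y - p‖ ^ 2 / ε ^ 2 - 1) • ((-⟪p, ‖y - p‖⁻¹ • (y - p)⟫ + Real.sqrt (⟪p, ‖y - p‖⁻¹ • (y - p)⟫ ^ 2 + (1 - ‖p‖ ^ 2))) • (‖y - p‖⁻¹ • (y - p)))‖ := norm_add_le _ _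
    _ = ‖p‖ + Real.smoothTransition (‖y - p‖ ^ 2 / ε ^ 2 - 1) * ‖(-⟪p, ‖y - p‖⁻¹ • (y - p)⟫ + Real.sqrt (⟪p, ‖y - p‖⁻¹ • (y - p)⟫ ^ 2 + (1 - ‖p‖ ^ 2))) • (‖y - p‖⁻¹ • (y - p))‖ := by
        rw [norm_smul, Real.norm_eq_abs, abs_of_nonneg hσ0]
    _ ≤ 1 / 2 + 1 * 2 := add_le_add hp (mul_le_mul hσ1 hg (norm_nonneg _) zero_le_one)
    _ ≤ 3 := by norm_num

/-- `N_ε` agrees with the constant `p` near every point of the OPEN ball `‖y − p‖ < ε`. [cite: HardtKinderlehrerLin1986, §2] -/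
theorem smoothRayProj_eventuallyEq_const (p y : V) {ε : ℝ} (hε : 0 < ε) (h : ‖y - p‖ < ε) :
    (fun y : V => p + Real.smoothTransition (‖y - p‖ ^ 2 / ε ^ 2 - 1) • ((-⟪p, ‖y - p‖⁻¹ • (y - p)⟫ + Real.sqrt (⟪p, ‖y - p‖⁻¹ • (y - p)⟫ ^ 2 + (1 - ‖p‖ ^ 2))) • (‖y - p‖⁻¹ • (y - p)))) =ᶠ[𝓝 y] fun _ => p := by
  have hopen : IsOpen {z : V | ‖z - p‖ < ε} := isOpen_lt (continuous_id.sub continuous_const).norm continuous_const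
  filter_upwards [hopen.mem_nhds h] with z hz
  exact smoothRayProj_eq_centre p z hε hz.le

/-- `N_ε` agrees with `π_p` near every point of the OPEN exterior `2ε² < ‖y − p‖²`. [cite: HardtKinderlehrerLin1986, §2] -/
theorem smoothRayProj_eventuallyEq_rayProj (p y : V) {ε : ℝ} (hε : 0 < ε) (h : 2 * ε ^ 2 < ‖y - p‖ ^ 2) :
    (fun y : V => p + Real.smoothTransition (‖y - p‖ ^ 2 / ε ^ 2 - 1) • ((-⟪p, ‖y - p‖⁻¹ • (y - p)⟫ + Real.sqrt (⟪p, ‖y - p‖⁻¹ • (y - p)⟫ ^ 2 + (1 - ‖p‖ ^ 2))) • (‖y - p‖⁻¹ • (y - p)))) =ᶠ[𝓝 y] (fun y : V => p + (-⟪p, ‖y - p‖⁻¹ • (y - p)⟫ + Real.sqrt (⟪p, ‖y - p‖⁻¹ • (y - p)⟫ ^ 2 + (1 - ‖p‖ ^ 2))) • (‖y - p‖⁻¹ • (y - p))) := by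
  have hopen : IsOpen {z : V | 2 * ε ^ 2 < ‖z - p‖ ^ 2} :=
    isOpen_lt continuous_const (((continuous_id.sub continuous_const).norm).pow 2)
  filter_upwards [hopen.mem_nhds h] with z hz
  exact smoothRayProj_eq_rayProj p z hε hz.le

/-- `N_ε` IS GLOBALLY `C^∞` (`‖p‖ ≤ ½`, `ε > 0`): locally the constant `p` on the open ball `‖y − p‖ < ε`; elsewhere `y ≠ p` and every factor is
smooth (`σ`, `‖· − p‖²`, and `s(p,e_y)•e_y` by `contDiffAt_rayProj_sub_centre`). [cite: HardtKinderlehrerLin1986, §2] -/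
theorem contDiff_smoothRayProj (p : V) (hp : ‖p‖ ≤ 1 / 2) {ε : ℝ} (hε : 0 < ε) :
    ContDiff ℝ ∞ (fun y : V => p + Real.smoothTransition (‖y - p‖ ^ 2 / ε ^ 2 - 1) • ((-⟪p, ‖y - p‖⁻¹ • (y - p)⟫ + Real.sqrt (⟪p, ‖y - p‖⁻¹ • (y - p)⟫ ^ 2 + (1 - ‖p‖ ^ 2))) • (‖y - p‖⁻¹ • (y - p)))) := by
  rw [contDiff_iff_contDiffAt]
  intro y
  by_cases h : ‖y - p‖ < ε
  · exact contDiffAt_const.congr_of_eventuallyEq (smoothRayProj_eventuallyEq_const p y hε h)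
  · have hy : y ≠ p := by
      intro hyp; apply h; rw [hyp, sub_self, norm_zero]; exact hε
    have ht : ContDiffAt ℝ ∞ (fun z : V => Real.smoothTransition (‖z - p‖ ^ 2 / ε ^ 2 - 1)) y := by
      have hx : ContDiffAt ℝ ∞ (fun z : V => ‖z - p‖ ^ 2 / ε ^ 2 - 1) y :=
        (((contDiffAt_id.sub contDiffAt_const).norm_sq ℝ).div_const (ε ^ 2)).sub contDiffAt_const
      exact Real.smoothTransition.contDiffAt.comp y hx
    exact contDiffAt_const.add (ht.smul (contDiffAt_rayProj_sub_centre p y hp hy))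

/-- `fderiv ℝ N_ε y = 0` on the open ball `‖y − p‖ < ε` (locally constant there); in particular at `y = p`. [cite: HardtKinderlehrerLin1986, §2] -/
theorem fderiv_smoothRayProj_eq_zero (p y : V) {ε : ℝ} (hε : 0 < ε) (h : ‖y - p‖ < ε) :
    fderiv ℝ (fun y : V => p + Real.smoothTransition (‖y - p‖ ^ 2 / ε ^ 2 - 1) • ((-⟪p, ‖y - p‖⁻¹ • (y - p)⟫ + Real.sqrt (⟪p, ‖y - p‖⁻¹ • (y - p)⟫ ^ 2 + (1 - ‖p‖ ^ 2))) • (‖y - p‖⁻¹ • (y - p)))) y = 0 := by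
  rw [(smoothRayProj_eventuallyEq_const p y hε h).fderiv_eq]
  exact fderiv_const_apply p

/-- `fderiv ℝ N_ε y = fderiv ℝ π_p y` on the open exterior `2ε² < ‖y − p‖²` (the two maps agree near `y`). [cite: HardtKinderlehrerLin1986, §2] -/
theorem fderiv_smoothRayProj_eq_fderiv_rayProj (p y : V) {ε : ℝ} (hε : 0 < ε) (h : 2 * ε ^ 2 < ‖y - p‖ ^ 2) :
    fderiv ℝ (fun y : V => p + Real.smoothTransition (‖y - p‖ ^ 2 / ε ^ 2 - 1) • ((-⟪p, ‖y - p‖⁻¹ • (y - p)⟫ + Real.sqrt (⟪p, ‖y - p‖⁻¹ • (y - p)⟫ ^ 2 + (1 - ‖p‖ ^ 2))) • (‖y - p‖⁻¹ • (y - p)))) y = fderiv ℝ (fun y : V => p + (-⟪p, ‖y - p‖⁻¹ • (y - p)⟫ + Real.sqrt (⟪p, ‖y - p‖⁻¹ • (y - p)⟫ ^ 2 + (1 - ‖p‖ ^ 2))) • (‖y - p‖⁻¹ • (y - p))) y :=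
  (smoothRayProj_eventuallyEq_rayProj p y hε h).fderiv_eq

/-- **THE ε-UNIFORM MAJORANT `‖DN_ε(y)‖ ≤ K∕‖y − p‖`** (`‖p‖ ≤ ½`; one `K ≥ 0` for all `ε > 0` and all `y`; at `y = p` both sides are `0` under
`0⁻¹ = 0`).  Three regimes: `‖y − p‖ < ε` (derivative `0`); `‖y − p‖² > 2ε²` (`= Dπ_p`, bound `6∕‖y − p‖`); the collar `ε ≤ ‖y − p‖ ≤ √2·ε`, where
`N_ε z − N_ε y = (σ_z − σ_y)•(π_p z − p) + σ_y•(π_p z − π_p y)` is locally `(10L + 6)∕‖y − p‖`-Lipschitz (`L` = Lipschitz constant of `σ`,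
`|‖z − p‖² − ‖y − p‖²| ≤ ‖z − y‖(‖z − p‖ + ‖y − p‖)`, `‖π_p z − p‖ ≤ 2`, `‖y − p‖∕ε² ≤ 2∕‖y − p‖`, H-1's `6∕‖y − p‖` bound), read by `norm_fderiv_le_of_lip'`.
[cite: HardtKinderlehrerLin1986, §2] -/
theorem exists_norm_fderiv_smoothRayProj_le (p : V) (hp : ‖p‖ ≤ 1 / 2) :
    ∃ K : ℝ, 0 ≤ K ∧ ∀ ε : ℝ, 0 < ε → ∀ y : V,
      ‖fderiv ℝ (fun y : V => p + Real.smoothTransition (‖y - p‖ ^ 2 / ε ^ 2 - 1) • ((-⟪p, ‖y - p‖⁻¹ • (y - p)⟫ + Real.sqrt (⟪p, ‖y - p‖⁻¹ • (y - p)⟫ ^ 2 + (1 - ‖p‖ ^ 2))) • (‖y - p‖⁻¹ • (y - p)))) y‖ ≤ K / ‖y - p‖ := by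
  obtain ⟨L, hL0, hL⟩ := exists_lipschitz_smoothTransition
  refine ⟨6 + 10 * L, by positivity, fun ε hε y => ?_⟩
  by_cases hA : ‖y - p‖ < ε
  · rw [fderiv_smoothRayProj_eq_zero p y hε hA, norm_zero]; positivity
  have hyp0 : 0 < ‖y - p‖ := lt_of_lt_of_le hε (not_lt.mp hA)
  have hy : y ≠ p := fun h => by rw [h, sub_self, norm_zero] at hyp0; exact lt_irrefl _ hyp0
  by_cases hB : 2 * ε ^ 2 < ‖y - p‖ ^ 2
  · rw [fderiv_smoothRayProj_eq_fderiv_rayProj p y hε hB]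
    exact (norm_fderiv_rayProj_le p y hp hy).trans (div_le_div_of_nonneg_right (by linarith) hyp0.le)
  -- the collar `ε ≤ ‖y − p‖`, `‖y − p‖² ≤ 2ε²`
  have hB' : ‖y - p‖ ^ 2 ≤ 2 * ε ^ 2 := not_lt.mp hB
  refine norm_fderiv_le_of_lip' ℝ (by positivity) ?_
  -- neighbourhood: `z ≠ p` and `‖z − y‖ < ‖y − p‖ ∕ 2`
  have hU : {z : V | z ≠ p} ∩ ball y (‖y - p‖ / 2) ∈ 𝓝 y :=
    inter_mem (isOpen_compl_singleton.mem_nhds hy) (ball_mem_nhds y (by positivity))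
  filter_upwards [hU] with z hz
  obtain ⟨hzp, hzy⟩ := hz
  have hzp' : z ≠ p := hzp
  rw [mem_ball, dist_eq_norm] at hzy
  -- abbreviations
  set σz : ℝ := Real.smoothTransition (‖z - p‖ ^ 2 / ε ^ 2 - 1) with hσz
  set σy : ℝ := Real.smoothTransition (‖y - p‖ ^ 2 / ε ^ 2 - 1) with hσy
  set gz : V := (-⟪p, ‖z - p‖⁻¹ • (z - p)⟫ + Real.sqrt (⟪p, ‖z - p‖⁻¹ • (z - p)⟫ ^ 2 + (1 - ‖p‖ ^ 2))) • (‖z - p‖⁻¹ • (z - p)) with hgz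
  set gy : V := (-⟪p, ‖y - p‖⁻¹ • (y - p)⟫ + Real.sqrt (⟪p, ‖y - p‖⁻¹ • (y - p)⟫ ^ 2 + (1 - ‖p‖ ^ 2))) • (‖y - p‖⁻¹ • (y - p)) with hgy
  have hdecomp : (p + σz • gz) - (p + σy • gy) = (σz - σy) • gz + σy • (gz - gy) := by
    rw [sub_smul, smul_sub]; abel
  -- term 1: `|σz − σy|·‖gz‖ ≤ L·|x_z − x_y|·2`
  have hgz2 : ‖gz‖ ≤ 2 := norm_root_smul_dir_le p z hp
  have hσ : |σz - σy| ≤ L * |(‖z - p‖ ^ 2 / ε ^ 2 - 1) - (‖y - p‖ ^ 2 / ε ^ 2 - 1)| := hL _ _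
  have hx : |(‖z - p‖ ^ 2 / ε ^ 2 - 1) - (‖y - p‖ ^ 2 / ε ^ 2 - 1)| = |‖z - p‖ ^ 2 - ‖y - p‖ ^ 2| / ε ^ 2 := by
    rw [show (‖z - p‖ ^ 2 / ε ^ 2 - 1) - (‖y - p‖ ^ 2 / ε ^ 2 - 1) = (‖z - p‖ ^ 2 - ‖y - p‖ ^ 2) / ε ^ 2 by ring,
      abs_div, abs_of_pos (by positivity : (0:ℝ) < ε ^ 2)]
  have hsq : |‖z - p‖ ^ 2 - ‖y - p‖ ^ 2| ≤ ‖z - y‖ * (‖z - p‖ + ‖y - p‖) := by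
    rw [sq_sub_sq, abs_mul, abs_of_nonneg (by positivity : (0:ℝ) ≤ ‖z - p‖ + ‖y - p‖), mul_comm]
    refine mul_le_mul_of_nonneg_right ?_ (by positivity)
    have := abs_norm_sub_norm_le (z - p) (y - p)
    rwa [show z - p - (y - p) = z - y by abel] at this
  have hzp_le : ‖z - p‖ ≤ 3 / 2 * ‖y - p‖ := by
    calc ‖z - p‖ = ‖(z - y) + (y - p)‖ := by congr 1; abel
      _ ≤ ‖z - y‖ + ‖y - p‖ := norm_add_le _ _
      _ ≤ 3 / 2 * ‖y - p‖ := by linarith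
  have hsum : ‖z - p‖ + ‖y - p‖ ≤ 5 / 2 * ‖y - p‖ := by linarith
  -- `‖y − p‖ ∕ ε² ≤ 2 ∕ ‖y − p‖`
  have hcollar : ‖y - p‖ / ε ^ 2 ≤ 2 / ‖y - p‖ := by
    rw [div_le_div_iff₀ (by positivity) hyp0]
    nlinarith
  have hterm1 : ‖(σz - σy) • gz‖ ≤ 10 * L / ‖y - p‖ * ‖z - y‖ := by
    rw [norm_smul, Real.norm_eq_abs]
    calc |σz - σy| * ‖gz‖ ≤ (L * (|‖z - p‖ ^ 2 - ‖y - p‖ ^ 2| / ε ^ 2)) * 2 := by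
          rw [← hx]; exact mul_le_mul hσ hgz2 (norm_nonneg _) (by positivity)
      _ ≤ (L * (‖z - y‖ * (5 / 2 * ‖y - p‖) / ε ^ 2)) * 2 := by
          gcongr
          exact hsq.trans (mul_le_mul_of_nonneg_left hsum (norm_nonneg _))
      _ = 5 * L * (‖y - p‖ / ε ^ 2) * ‖z - y‖ := by ring
      _ ≤ 5 * L * (2 / ‖y - p‖) * ‖z - y‖ := by gcongr
      _ = 10 * L / ‖y - p‖ * ‖z - y‖ := by ring
  -- term 2: `σy·‖gz − gy‖ ≤ 6‖z − y‖∕‖y − p‖`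
  have hσy0 : 0 ≤ σy := Real.smoothTransition.nonneg _
  have hσy1 : σy ≤ 1 := Real.smoothTransition.le_one _
  have hπ : ‖gz - gy‖ ≤ 6 / ‖y - p‖ * ‖z - y‖ := by
    have h := norm_rayProj_sub_rayProj_le p y z hp hy hzp'
    have heq : (p + gy) - (p + gz) = -(gz - gy) := by abel
    rw [heq, norm_neg] at h
    calc ‖gz - gy‖ ≤ 6 * ‖y - z‖ / ‖y - p‖ := h
      _ = 6 / ‖y - p‖ * ‖z - y‖ := by rw [norm_sub_rev y z]; ring
  have hterm2 : ‖σy • (gz - gy)‖ ≤ 6 / ‖y - p‖ * ‖z - y‖ := by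
    rw [norm_smul, Real.norm_eq_abs, abs_of_nonneg hσy0]
    calc σy * ‖gz - gy‖ ≤ 1 * ‖gz - gy‖ := mul_le_mul_of_nonneg_right hσy1 (norm_nonneg _)
      _ ≤ 6 / ‖y - p‖ * ‖z - y‖ := by rw [one_mul]; exact hπ
  calc ‖(p + σz • gz) - (p + σy • gy)‖ = ‖(σz - σy) • gz + σy • (gz - gy)‖ := by rw [hdecomp]
    _ ≤ ‖(σz - σy) • gz‖ + ‖σy • (gz - gy)‖ := norm_add_le _ _
    _ ≤ 10 * L / ‖y - p‖ * ‖z - y‖ + 6 / ‖y - p‖ * ‖z - y‖ := add_le_add hterm1 hterm2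
    _ = (6 + 10 * L) / ‖y - p‖ * ‖z - y‖ := by ring

/-- THE GLOBAL DERIVATIVE BOUND OF EACH `N_ε` : `∀ ε > 0, ∃ C, ∀ y, ‖fderiv ℝ N_ε y‖ ≤ C` (`C = K∕ε`: the derivative vanishes
on `‖y − p‖ < ε` and is `≤ K∕‖y − p‖ ≤ K∕ε` outside). [cite: HardtKinderlehrerLin1986, §2] -/
theorem exists_norm_fderiv_smoothRayProj_le_const (p : V) (hp : ‖p‖ ≤ 1 / 2) {ε : ℝ} (hε : 0 < ε) :
    ∃ C : ℝ, ∀ y : V, ‖fderiv ℝ (fun y : V => p + Real.smoothTransition (‖y - p‖ ^ 2 / ε ^ 2 - 1) • ((-⟪p, ‖y - p‖⁻¹ • (y - p)⟫ + Real.sqrt (⟪p, ‖y - p‖⁻¹ • (y - p)⟫ ^ 2 + (1 - ‖p‖ ^ 2))) • (‖y - p‖⁻¹ • (y - p)))) y‖ ≤ C := by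
  obtain ⟨K, hK0, hK⟩ := exists_norm_fderiv_smoothRayProj_le p hp
  refine ⟨K / ε, fun y => ?_⟩
  by_cases hA : ‖y - p‖ < ε
  · rw [fderiv_smoothRayProj_eq_zero p y hε hA, norm_zero]; positivity
  · exact (hK ε hε y).trans (div_le_div_of_nonneg_left hK0 hε (not_lt.mp hA))

/-- `2·(1∕(n+1))² < c` for all large `n` (`c > 0`). [cite: HardtKinderlehrerLin1986, §2] -/
theorem eventually_two_mul_sq_inv_succ_lt {c : ℝ} (hc : 0 < c) :
    ∀ᶠ n : ℕ in atTop, 2 * (1 / ((n:ℝ) + 1)) ^ 2 < c := by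
  have h := (tendsto_one_div_add_atTop_nhds_zero_nat (𝕜 := ℝ)).pow 2
  rw [zero_pow two_ne_zero] at h
  have ht : Tendsto (fun n : ℕ => 2 * (1 / ((n:ℝ) + 1)) ^ 2) atTop (𝓝 0) := by simpa using h.const_mul 2
  exact ht.eventually (eventually_lt_nhds hc)

/-- EVENTUAL EQUALITY OF VALUES along `ε_n := 1∕(n+1)`: at EVERY `y` (including `y = p`, where both sides are `p`),
`N_(ε_n) y = π_p y` for all large `n`. [cite: HardtKinderlehrerLin1986, §2] -/
theorem eventually_smoothRayProj_eq (p y : V) :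
    ∀ᶠ n : ℕ in atTop, p + Real.smoothTransition (‖y - p‖ ^ 2 / (1 / ((n:ℝ) + 1)) ^ 2 - 1) • ((-⟪p, ‖y - p‖⁻¹ • (y - p)⟫ + Real.sqrt (⟪p, ‖y - p‖⁻¹ • (y - p)⟫ ^ 2 + (1 - ‖p‖ ^ 2))) • (‖y - p‖⁻¹ • (y - p))) = p + (-⟪p, ‖y - p‖⁻¹ • (y - p)⟫ + Real.sqrt (⟪p, ‖y - p‖⁻¹ • (y - p)⟫ ^ 2 + (1 - ‖p‖ ^ 2))) • (‖y - p‖⁻¹ • (y - p)) := by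
  by_cases hy : y = p
  · subst hy
    refine Eventually.of_forall fun n => ?_
    rw [smoothRayProj_eq_centre y y (by positivity) (by rw [sub_self, norm_zero]; positivity), rayProj_self]
  · have hpos : 0 < ‖y - p‖ ^ 2 := by
      have := norm_pos_iff.mpr (sub_ne_zero.mpr hy); positivity
    filter_upwards [eventually_two_mul_sq_inv_succ_lt hpos] with n hn
    exact smoothRayProj_eq_rayProj p y (by positivity) hn.le

/-- EVENTUAL EQUALITY OF DERIVATIVES along `ε_n := 1∕(n+1)`: at EVERY `y` (including `y = p`, where both sides are `0`),
`fderiv ℝ N_(ε_n) y = fderiv ℝ π_p y` for all large `n` (`‖p‖ ≤ ½`). [cite: HardtKinderlehrerLin1986, §2] -/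
theorem eventually_fderiv_smoothRayProj_eq (p y : V) (hp : ‖p‖ ≤ 1 / 2) :
    ∀ᶠ n : ℕ in atTop, fderiv ℝ (fun y : V => p + Real.smoothTransition (‖y - p‖ ^ 2 / (1 / ((n:ℝ) + 1)) ^ 2 - 1) • ((-⟪p, ‖y - p‖⁻¹ • (y - p)⟫ + Real.sqrt (⟪p, ‖y - p‖⁻¹ • (y - p)⟫ ^ 2 + (1 - ‖p‖ ^ 2))) • (‖y - p‖⁻¹ • (y - p)))) y = fderiv ℝ (fun y : V => p + (-⟪p, ‖y - p‖⁻¹ • (y - p)⟫ + Real.sqrt (⟪p, ‖y - p‖⁻¹ • (y - p)⟫ ^ 2 + (1 - ‖p‖ ^ 2))) • (‖y - p‖⁻¹ • (y - p))) y := by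
  by_cases hy : y = p
  · subst hy
    refine Eventually.of_forall fun n => ?_
    rw [fderiv_smoothRayProj_eq_zero y y (by positivity) (by rw [sub_self, norm_zero]; positivity),
      fderiv_rayProj_centre y hp]
  · have hpos : 0 < ‖y - p‖ ^ 2 := by
      have := norm_pos_iff.mpr (sub_ne_zero.mpr hy); positivity
    filter_upwards [eventually_two_mul_sq_inv_succ_lt hpos] with n hn
    exact fderiv_smoothRayProj_eq_fderiv_rayProj p y (by positivity) hn

end Literature.Analysis.PDE.MinimisingMaps

end Part4

/-!
## Part 5 — port of `Summits/QuantumFields/YangMills/Theorems/PoincareLipschitzSobolevRayProjectionComp.lean` (3 declarations kept)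

# Energy minimising maps into `S³` (Hardt–Kinderlehrer–Lin / Luckhaus / Simon §2.9): Sobolev Ray Projection Comp

Declarations of this Part (verbatim port; each keeps its own docstring and citation): `hasWeakFDerivOn_rayProj_comp`, `norm_fderiv_rayProj_le_all`, `dens_rayProj_comp_le`.

Reference keys (see `references.bib` and the declarations' citations): [HardtKinderlehrerLin1986], [EvansGariepy1992].
-/

section Part5

open _root_.MeasureTheory _root_.Set _root_.Function _root_.Filter _root_.Topology _root_.Metric _root_.TopologicalSpace
open scoped _root_.ContDiff _root_.ENNReal _root_.BigOperators _root_.InnerProductSpace RealInnerProductSpace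

namespace Literature.Analysis.PDE.MinimisingMaps

open Literature.Analysis.FunctionSpaces

variable {E : Type*} [NormedAddCommGroup E] [InnerProductSpace ℝ E] [FiniteDimensional ℝ E]
  [MeasurableSpace E] [BorelSpace E] {μ : Measure E} [μ.IsAddHaarMeasure]
variable {V : Type*} [NormedAddCommGroup V] [InnerProductSpace ℝ V] [CompleteSpace V]

/-- **THE HKL RAY PROJECTION OF A SOBOLEV MAP IS SOBOLEV**, with weak gradient `Dπ_p(w) ∘ Gw` (junk `0` on the fibre `{w = p}`):
if `w` has weak gradient `Gw` on `Ω` and `x ↦ ‖w x − p‖⁻¹·‖Gw x‖` is locally integrable on `Ω` (`‖p‖ ≤ ½`), then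
`π_p ∘ w` has weak gradient `x ↦ Dπ_p(w x) ∘ Gw x` on `Ω` — `hasWeakFDerivOn_comp_of_eventuallyEq_approx` fed with
regularised family (`PoincareLipschitzSphereRayProjectionCalculus`). [cite: HardtKinderlehrerLin1986, §2; EvansGariepy1992, §4.2.2 Thm 4 (ii)] -/
theorem hasWeakFDerivOn_rayProj_comp {Ω : Opens E} {w : E → V} {Gw : E → E →L[ℝ] V}
    (hw : HasWeakFDerivOn Ω μ w Gw) (p : V) (hp : ‖p‖ ≤ 1 / 2)
    (hInt : LocallyIntegrableOn (fun x => ‖w x - p‖⁻¹ * ‖Gw x‖) (Ω : Set E) μ) :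
    HasWeakFDerivOn Ω μ
      (fun x => p + (-⟪p, ‖w x - p‖⁻¹ • (w x - p)⟫ +
        Real.sqrt (⟪p, ‖w x - p‖⁻¹ • (w x - p)⟫ ^ 2 + (1 - ‖p‖ ^ 2))) • (‖w x - p‖⁻¹ • (w x - p)))
      (fun x => (fderiv ℝ (fun y : V => p + (-⟪p, ‖y - p‖⁻¹ • (y - p)⟫ +
        Real.sqrt (⟪p, ‖y - p‖⁻¹ • (y - p)⟫ ^ 2 + (1 - ‖p‖ ^ 2))) • (‖y - p‖⁻¹ • (y - p))) (w x)).comp (Gw x)) := by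
  obtain ⟨K, hK0, hK⟩ := exists_norm_fderiv_smoothRayProj_le p hp
  have hpos : ∀ n : ℕ, (0 : ℝ) < 1 / ((n : ℝ) + 1) := fun n => by positivity
  refine hasWeakFDerivOn_comp_of_eventuallyEq_approx (μ := μ) hw
    (P := fun y : V => p + (-⟪p, ‖y - p‖⁻¹ • (y - p)⟫ +
        Real.sqrt (⟪p, ‖y - p‖⁻¹ • (y - p)⟫ ^ 2 + (1 - ‖p‖ ^ 2))) • (‖y - p‖⁻¹ • (y - p)))
    (N := fun n (y : V) => p + Real.smoothTransition (‖y - p‖ ^ 2 / (1 / ((n:ℝ) + 1)) ^ 2 - 1) •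
      ((-⟪p, ‖y - p‖⁻¹ • (y - p)⟫ + Real.sqrt (⟪p, ‖y - p‖⁻¹ • (y - p)⟫ ^ 2 + (1 - ‖p‖ ^ 2))) • (‖y - p‖⁻¹ • (y - p))))
    (fun n => contDiff_smoothRayProj p hp (hpos n)) (fun n => exists_norm_fderiv_smoothRayProj_le_const p hp (hpos n))
    (B := 3) (fun n y => norm_smoothRayProj_le p y hp _) (fun y => eventually_smoothRayProj_eq p y)
    (fun y => eventually_fderiv_smoothRayProj_eq p y hp) (M := fun y => K / ‖y - p‖) (fun n y => hK _ (hpos n) y) ?_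
  -- the majorant `K∕‖w − p‖ · ‖Gw‖ = K · (‖w − p‖⁻¹‖Gw‖)` is locally integrable
  have hfun : (fun x => K / ‖w x - p‖ * ‖Gw x‖) = K • fun x => ‖w x - p‖⁻¹ * ‖Gw x‖ := by
    funext x
    simp only [Pi.smul_apply, smul_eq_mul, div_eq_mul_inv, mul_assoc]
  rw [hfun]
  exact hInt.smul K

omit [CompleteSpace V] in
/-- The operator-norm majorant `‖Dπ_p y‖ ≤ 6∕‖y − p‖` at EVERY `y` (at the centre both sides vanish: junk `fderiv = 0`, `6∕0 = 0`).
[cite: HardtKinderlehrerLin1986, §2] -/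
theorem norm_fderiv_rayProj_le_all (p : V) (hp : ‖p‖ ≤ 1 / 2) (y : V) :
    ‖fderiv ℝ (fun y : V => p + (-⟪p, ‖y - p‖⁻¹ • (y - p)⟫ +
        Real.sqrt (⟪p, ‖y - p‖⁻¹ • (y - p)⟫ ^ 2 + (1 - ‖p‖ ^ 2))) • (‖y - p‖⁻¹ • (y - p))) y‖ ≤ 6 / ‖y - p‖ := by
  by_cases hy : y = p
  · subst hy
    rw [fderiv_rayProj_centre y hp, norm_zero, sub_self, norm_zero, div_zero]
  · exact norm_fderiv_rayProj_le p y hp hy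

omit [CompleteSpace V] in
/-- **THE ENERGY DENSITY OF THE PROJECTED MAP**: on `ℝ³`, `Σᵢ‖(Dπ_p(w x) ∘ Gw x) eᵢ‖² ≤ (6∕‖w x − p‖)²·Σᵢ‖Gw x eᵢ‖²`
(`= 36·dens(Gw)∕‖w − p‖²` off the fibre, `0 ≤ 0` on it). [cite: HardtKinderlehrerLin1986, §2] -/
theorem dens_rayProj_comp_le (p : V) (hp : ‖p‖ ≤ 1 / 2) {w : EuclideanSpace ℝ (Fin 3) → V}
    {Gw : EuclideanSpace ℝ (Fin 3) → EuclideanSpace ℝ (Fin 3) →L[ℝ] V} (x : EuclideanSpace ℝ (Fin 3)) :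
    ∑ i : Fin 3, ‖((fderiv ℝ (fun y : V => p + (-⟪p, ‖y - p‖⁻¹ • (y - p)⟫ +
        Real.sqrt (⟪p, ‖y - p‖⁻¹ • (y - p)⟫ ^ 2 + (1 - ‖p‖ ^ 2))) • (‖y - p‖⁻¹ • (y - p))) (w x)).comp (Gw x))
        (EuclideanSpace.single i (1:ℝ))‖ ^ 2 ≤
      (6 / ‖w x - p‖) ^ 2 * ∑ i : Fin 3, ‖Gw x (EuclideanSpace.single i (1:ℝ))‖ ^ 2 :=
  sum_norm_sq_comp_apply_le (Finset.univ : Finset (Fin 3)) (fun i => EuclideanSpace.single i (1:ℝ))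
    (M' := fun y => 6 / ‖y - p‖) (norm_fderiv_rayProj_le_all p hp) x

end Literature.Analysis.PDE.MinimisingMaps

end Part5

/-!
## Part 6 — port of `Summits/QuantumFields/YangMills/Theorems/PoincareLipschitzHKLCompetitor.lean` (11 declarations kept)

# Energy minimising maps into `S³` (Hardt–Kinderlehrer–Lin / Luckhaus / Simon §2.9): HKLCompetitor

Declarations of this Part (verbatim port; each keeps its own docstring and citation): `cube_subset_ball_two`, `volume_cube_lt_top`, `aestronglyMeasurable_dens`, `opNorm_le_sum_norm_apply_single`, `inv_mul_opNorm_le`, `exists_countable_null_fibres`, `integrableOn_weight_of_caps`, `exists_unit_modification`, `integrableOn_inv_norm_mul_opNorm`, `shell_bound_arith`, `exists_hkl_competitor`.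

Reference keys (see `references.bib` and the declarations' citations): [HardtKinderlehrerLin1986], [Simon1996].
-/

section Part6

open _root_.MeasureTheory _root_.Set _root_.Filter _root_.Topology _root_.TopologicalSpace _root_.Metric
open scoped _root_.NNReal _root_.BigOperators _root_.InnerProductSpace
open RealInnerProductSpace

namespace Literature.Analysis.PDE.MinimisingMaps

open Literature.Analysis.FunctionSpaces (HasWeakFDerivOn)
open Literature.Analysis.FunctionSpaces.MeyersSerrin (hasWeakFDerivOn_congr_ae)

/-! ## §1 Letters -/

/-- The open unit cube `{|xᵢ| < 1}` of `ℝ³` lies in the ball `B_2(0)` (`‖x‖² = Σ xᵢ² ≤ 3 < 4`). [cite: HardtKinderlehrerLin1986, §2] -/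
theorem cube_subset_ball_two :
    {x : EuclideanSpace ℝ (Fin 3) | ∀ i : Fin 3, |x i| < 1} ⊆ ball (0 : EuclideanSpace ℝ (Fin 3)) 2 := by
  intro x hx
  rw [mem_ball_zero_iff, EuclideanSpace.norm_eq]
  have hs : ∑ i : Fin 3, ‖x i‖ ^ 2 ≤ 3 := by
    have h1 : ∀ i : Fin 3, ‖x i‖ ^ 2 ≤ 1 := fun i => by
      rw [Real.norm_eq_abs]
      have := hx i
      nlinarith [abs_nonneg (x i)]
    calc ∑ i : Fin 3, ‖x i‖ ^ 2 ≤ ∑ _i : Fin 3, (1:ℝ) := Finset.sum_le_sum fun i _ => h1 i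
      _ = 3 := by simp
  calc Real.sqrt (∑ i : Fin 3, ‖x i‖ ^ 2) ≤ Real.sqrt 3 := Real.sqrt_le_sqrt hs
    _ < 2 := by rw [Real.sqrt_lt' (by norm_num)]; norm_num

/-- The open unit cube of `ℝ³` has finite volume. [cite: HardtKinderlehrerLin1986, §2] -/
theorem volume_cube_lt_top : volume {x : EuclideanSpace ℝ (Fin 3) | ∀ i : Fin 3, |x i| < 1} < ⊤ :=
  (measure_mono cube_subset_ball_two).trans_lt measure_ball_lt_top

/-- The S1″ density `x ↦ Σᵢ ‖G x eᵢ‖²` is a.e.-strongly measurable when `G` is. [cite: HardtKinderlehrerLin1986, §2] -/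
theorem aestronglyMeasurable_dens {μ : Measure (EuclideanSpace ℝ (Fin 3))}
    {G : EuclideanSpace ℝ (Fin 3) → (EuclideanSpace ℝ (Fin 3) →L[ℝ] EuclideanSpace ℝ (Fin 4))} (hG : AEStronglyMeasurable G μ) :
    AEStronglyMeasurable (fun x => ∑ i : Fin 3, ‖G x (EuclideanSpace.single i (1:ℝ))‖ ^ 2) μ :=
  Finset.aestronglyMeasurable_fun_sum _ fun i _ => (hG.apply_continuousLinearMap (EuclideanSpace.single i (1:ℝ))).norm.pow 2

/-- The operator norm of a linear map on `ℝ³` is at most the SUM of the norms of the images of the coordinate vectors: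
`‖T‖ ≤ Σᵢ ‖T eᵢ‖` (`v = Σ vᵢ eᵢ`, `|vᵢ| ≤ ‖v‖`). [cite: HardtKinderlehrerLin1986, §2] -/
theorem opNorm_le_sum_norm_apply_single {F : Type*} [NormedAddCommGroup F] [NormedSpace ℝ F]
    (T : EuclideanSpace ℝ (Fin 3) →L[ℝ] F) :
    ‖T‖ ≤ ∑ i : Fin 3, ‖T (EuclideanSpace.single i (1:ℝ))‖ := by
  refine ContinuousLinearMap.opNorm_le_bound _ (Finset.sum_nonneg fun i _ => norm_nonneg _) fun v => ?_
  have hv : T v = ∑ i : Fin 3, v i • T (EuclideanSpace.single i (1:ℝ)) := by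
    conv_lhs => rw [← (EuclideanSpace.basisFun (Fin 3) ℝ).sum_repr v]
    rw [map_sum]
    refine Finset.sum_congr rfl fun i _ => ?_
    rw [map_smul, EuclideanSpace.basisFun_repr, EuclideanSpace.basisFun_apply]
  have hvi : ∀ i : Fin 3, |v i| ≤ ‖v‖ := fun i => by
    rw [EuclideanSpace.norm_eq]
    refine Real.le_sqrt_of_sq_le ?_
    have : |v i| ^ 2 = ‖v i‖ ^ 2 := by rw [Real.norm_eq_abs]
    rw [this]
    exact Finset.single_le_sum (f := fun j => ‖v j‖ ^ 2) (fun j _ => sq_nonneg _) (Finset.mem_univ i)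
  rw [hv, Finset.sum_mul]
  refine (norm_sum_le _ _).trans (Finset.sum_le_sum fun i _ => ?_)
  rw [norm_smul, Real.norm_eq_abs, mul_comm]
  exact mul_le_mul_of_nonneg_left (hvi i) (norm_nonneg _)

/-- The HKL weight dominates the chain-rule integrand: for `r ≥ 0`, `r·‖T‖ ≤ ½·(Σᵢ ‖T eᵢ‖²)·r² + 3∕2` (AM–GM per coordinate on
`opNorm_le_sum_norm_apply_single`). Used with `r := ‖w x − p‖⁻¹`. [cite: HardtKinderlehrerLin1986, §2] -/
theorem inv_mul_opNorm_le {F : Type*} [NormedAddCommGroup F] [NormedSpace ℝ F]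
    (T : EuclideanSpace ℝ (Fin 3) →L[ℝ] F) {r : ℝ} (hr : 0 ≤ r) :
    r * ‖T‖ ≤ 2⁻¹ * ((∑ i : Fin 3, ‖T (EuclideanSpace.single i (1:ℝ))‖ ^ 2) * r ^ 2) + 3 / 2 := by
  have h1 : r * ‖T‖ ≤ ∑ i : Fin 3, r * ‖T (EuclideanSpace.single i (1:ℝ))‖ := by
    rw [← Finset.mul_sum]
    exact mul_le_mul_of_nonneg_left (opNorm_le_sum_norm_apply_single T) hr
  have h2 : ∀ i : Fin 3, r * ‖T (EuclideanSpace.single i (1:ℝ))‖ ≤ 2⁻¹ * (‖T (EuclideanSpace.single i (1:ℝ))‖ ^ 2 * r ^ 2) + 2⁻¹ :=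
    fun i => by nlinarith [sq_nonneg (r * ‖T (EuclideanSpace.single i (1:ℝ))‖ - 1)]
  refine h1.trans ((Finset.sum_le_sum fun i _ => h2 i).trans (le_of_eq ?_))
  simp only [Finset.sum_add_distrib, Finset.sum_const, Finset.card_univ, Fintype.card_fin, nsmul_eq_mul, Finset.sum_mul,
    Finset.mul_sum]
  norm_num

/-- **The atoms of an a.e.-measurable map into `ℝ⁴` are countable**: for an s-finite measure `μ` on `ℝ³` and `w` a.e.-strongly measurable,
there is a countable `N ⊂ ℝ⁴` off which every fibre `{w = p}` is `μ`-null (disjoint level sets; Mathlib `countable_meas_level_set_pos₀`). [cite: HardtKinderlehrerLin1986, §2] -/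
theorem exists_countable_null_fibres (μ : Measure (EuclideanSpace ℝ (Fin 3))) [SFinite μ]
    {w : EuclideanSpace ℝ (Fin 3) → EuclideanSpace ℝ (Fin 4)} (hw : AEStronglyMeasurable w μ) :
    ∃ N : Set (EuclideanSpace ℝ (Fin 4)), N.Countable ∧ ∀ p ∉ N, μ {x | w x = p} = 0 := by
  refine ⟨{p | 0 < μ {x | w x = p}}, Measure.countable_meas_level_set_pos₀ hw.aemeasurable.nullMeasurable, fun p hp => ?_⟩
  simpa only [mem_setOf_eq, not_lt, nonpos_iff_eq_zero] using hp

/-- **The HKL weight is integrable on the cube once it is on the shell.**  If `dens(Gw)` is integrable on a measurable `Q`, the weight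
`dens(Gw)·(‖w − p‖²)⁻¹` is integrable on a measurable `S`, and off `S` (inside `Q`) the map `w` is unit while `‖p‖ ≤ ½` (so `‖w − p‖ ≥ ½` and the
weight is `≤ 4·dens(Gw)` there), then the weight is integrable on `Q`. [folklore] [cite: HardtKinderlehrerLin1986, §2] -/
theorem integrableOn_weight_of_caps {Q S : Set (EuclideanSpace ℝ (Fin 3))} (hQm : MeasurableSet Q) (hS : MeasurableSet S)
    {w : EuclideanSpace ℝ (Fin 3) → EuclideanSpace ℝ (Fin 4)}
    {Gw : EuclideanSpace ℝ (Fin 3) → (EuclideanSpace ℝ (Fin 3) →L[ℝ] EuclideanSpace ℝ (Fin 4))} {p : EuclideanSpace ℝ (Fin 4)}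
    (hp : ‖p‖ ≤ 1 / 2) (hwm : AEStronglyMeasurable w (volume.restrict Q)) (hGwm : AEStronglyMeasurable Gw (volume.restrict Q))
    (hd : IntegrableOn (fun x => ∑ i : Fin 3, ‖Gw x (EuclideanSpace.single i (1:ℝ))‖ ^ 2) Q volume)
    (hSw : IntegrableOn (fun x => (∑ i : Fin 3, ‖Gw x (EuclideanSpace.single i (1:ℝ))‖ ^ 2) * (‖w x - p‖ ^ 2)⁻¹) S volume)
    (hcap : ∀ x ∈ Q, x ∉ S → ‖w x‖ = 1) :
    IntegrableOn (fun x => (∑ i : Fin 3, ‖Gw x (EuclideanSpace.single i (1:ℝ))‖ ^ 2) * (‖w x - p‖ ^ 2)⁻¹) Q volume := by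
  set f : EuclideanSpace ℝ (Fin 3) → ℝ := fun x => (∑ i : Fin 3, ‖Gw x (EuclideanSpace.single i (1:ℝ))‖ ^ 2) * (‖w x - p‖ ^ 2)⁻¹ with hf
  -- the indicator of the shell part is integrable on `Q`
  have h1 : IntegrableOn (S.indicator f) Q volume := by
    rw [IntegrableOn, integrable_indicator_iff hS, IntegrableOn, Measure.restrict_restrict hS]
    exact hSw.mono_set inter_subset_left
  have hg : IntegrableOn (fun x => S.indicator f x + 4 * ∑ i : Fin 3, ‖Gw x (EuclideanSpace.single i (1:ℝ))‖ ^ 2) Q volume :=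
    h1.add (hd.const_mul 4)
  have hfm : AEStronglyMeasurable f (volume.restrict Q) := by
    have h2 : AEMeasurable (fun x => (‖w x - p‖ ^ 2)⁻¹) (volume.restrict Q) :=
      ((hwm.aemeasurable.sub_const p).norm.pow_const 2).inv
    exact ((aestronglyMeasurable_dens hGwm).aemeasurable.mul h2).aestronglyMeasurable
  refine Integrable.mono' hg hfm ((ae_restrict_iff' hQm).mpr (ae_of_all _ fun x hxQ => ?_))
  have hd0 : 0 ≤ ∑ i : Fin 3, ‖Gw x (EuclideanSpace.single i (1:ℝ))‖ ^ 2 := Finset.sum_nonneg fun i _ => by positivity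
  have hf0 : 0 ≤ f x := mul_nonneg hd0 (inv_nonneg.mpr (sq_nonneg _))
  rw [Real.norm_of_nonneg hf0]
  by_cases hxS : x ∈ S
  · rw [indicator_of_mem hxS]
    linarith
  · rw [indicator_of_notMem hxS, zero_add]
    have h1x : ‖w x‖ = 1 := hcap x hxQ hxS
    have hge : 1 / 2 ≤ ‖w x - p‖ := by
      have := norm_sub_norm_le (w x) p
      linarith
    have hsq : 1 / 4 ≤ ‖w x - p‖ ^ 2 := by nlinarith
    have hinv : (‖w x - p‖ ^ 2)⁻¹ ≤ 4 := by
      calc (‖w x - p‖ ^ 2)⁻¹ ≤ (1 / 4 : ℝ)⁻¹ := inv_anti₀ (by norm_num) hsq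
        _ = 4 := by norm_num
    calc f x = (∑ i : Fin 3, ‖Gw x (EuclideanSpace.single i (1:ℝ))‖ ^ 2) * (‖w x - p‖ ^ 2)⁻¹ := rfl
      _ ≤ (∑ i : Fin 3, ‖Gw x (EuclideanSpace.single i (1:ℝ))‖ ^ 2) * 4 := mul_le_mul_of_nonneg_left hinv hd0
      _ = 4 * ∑ i : Fin 3, ‖Gw x (EuclideanSpace.single i (1:ℝ))‖ ^ 2 := by ring

/-- **The everywhere-unit representative of `π_p ∘ w`.**  With `‖p‖ ≤ ½`, `u` unit on a measurable `Q`, and the fibre `{w = p}` null in `Q`: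
`W x := π_p (w x)` for `x ∈ Q` off the fibre, `W x := u x` on the fibre and off `Q`.  Then `W` is unit on `Q`, `W = π_p ∘ w` a.e. on `Q`,
`W = w` wherever `w` is unit in `Q` (`π_p` fixes the sphere), and `W = u` off `Q`.  (`π_p y = p + s(p,e_y)•e_y`, `e_y = ‖y − p‖⁻¹•(y − p)`, spelled
out as in `PoincareLipschitzSphereRayProjection`.) [cite: HardtKinderlehrerLin1986, §2] -/
theorem exists_unit_modification {Q : Set (EuclideanSpace ℝ (Fin 3))} (hQm : MeasurableSet Q)
    {w u : EuclideanSpace ℝ (Fin 3) → EuclideanSpace ℝ (Fin 4)} {p : EuclideanSpace ℝ (Fin 4)} (hp : ‖p‖ ≤ 1 / 2)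
    (hu1 : ∀ x ∈ Q, ‖u x‖ = 1) (hnull : volume.restrict Q {x | w x = p} = 0) :
    ∃ W : EuclideanSpace ℝ (Fin 3) → EuclideanSpace ℝ (Fin 4),
      (∀ x ∈ Q, ‖W x‖ = 1) ∧
      (W =ᵐ[volume.restrict Q] fun x =>
        p + (-⟪p, ‖w x - p‖⁻¹ • (w x - p)⟫ + Real.sqrt (⟪p, ‖w x - p‖⁻¹ • (w x - p)⟫ ^ 2 + (1 - ‖p‖ ^ 2))) •
          (‖w x - p‖⁻¹ • (w x - p))) ∧
      (∀ x ∈ Q, ‖w x‖ = 1 → W x = w x) ∧ (∀ x, x ∉ Q → W x = u x) := by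
  classical
  set π : EuclideanSpace ℝ (Fin 4) → EuclideanSpace ℝ (Fin 4) := fun z =>
    p + (-⟪p, ‖z - p‖⁻¹ • (z - p)⟫ + Real.sqrt (⟪p, ‖z - p‖⁻¹ • (z - p)⟫ ^ 2 + (1 - ‖p‖ ^ 2))) • (‖z - p‖⁻¹ • (z - p)) with hπ
  refine ⟨fun x => if x ∈ Q then (if w x = p then u x else π (w x)) else u x, fun x hx => ?_, ?_, fun x hx h1 => ?_, fun x hx => ?_⟩
  · by_cases hwp : w x = p
    · simp only [hx, hwp, if_true]
      exact hu1 x hx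
    · simp only [hx, hwp, if_true, if_false, hπ]
      exact norm_rayProj_eq_one p (w x) hp hwp
  · have hae : ∀ᵐ x ∂(volume.restrict Q), x ∉ {x | w x = p} := measure_eq_zero_iff_ae_notMem.1 hnull
    filter_upwards [hae, ae_restrict_mem hQm] with x hx hxQ
    have hx' : ¬ w x = p := hx
    simp only [hxQ, hx', if_true, if_false, hπ]
  · have hwp : w x ≠ p := by
      intro h; rw [h] at h1; linarith
    simp only [hx, hwp, if_true, if_false, hπ]
    exact rayProj_eq_self_of_norm_eq_one p (w x) hp h1
  · simp only [hx, if_false]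

/-- The chain-rule integrand `‖w − p‖⁻¹·‖Gw‖` is integrable on a finite-volume measurable `Q` once the HKL weight `dens(Gw)·‖w − p‖⁻²` is
(`inv_mul_opNorm_le`). [cite: HardtKinderlehrerLin1986, §2] -/
theorem integrableOn_inv_norm_mul_opNorm {Q : Set (EuclideanSpace ℝ (Fin 3))} (hQfin : volume Q < ⊤)
    {w : EuclideanSpace ℝ (Fin 3) → EuclideanSpace ℝ (Fin 4)}
    {Gw : EuclideanSpace ℝ (Fin 3) → (EuclideanSpace ℝ (Fin 3) →L[ℝ] EuclideanSpace ℝ (Fin 4))} {p : EuclideanSpace ℝ (Fin 4)}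
    (hwm : AEStronglyMeasurable w (volume.restrict Q)) (hGwm : AEStronglyMeasurable Gw (volume.restrict Q))
    (hQw : IntegrableOn (fun x => (∑ i : Fin 3, ‖Gw x (EuclideanSpace.single i (1:ℝ))‖ ^ 2) * (‖w x - p‖ ^ 2)⁻¹) Q volume) :
    IntegrableOn (fun x => ‖w x - p‖⁻¹ * ‖Gw x‖) Q volume := by
  haveI : IsFiniteMeasure (volume.restrict Q) := ⟨by rw [Measure.restrict_apply_univ]; exact hQfin⟩
  have hg : IntegrableOn (fun x => 2⁻¹ * ((∑ i : Fin 3, ‖Gw x (EuclideanSpace.single i (1:ℝ))‖ ^ 2) * (‖w x - p‖ ^ 2)⁻¹) + 3 / 2)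
      Q volume :=
    (hQw.const_mul 2⁻¹).add (integrable_const _)
  have hfm : AEStronglyMeasurable (fun x => ‖w x - p‖⁻¹ * ‖Gw x‖) (volume.restrict Q) :=
    ((hwm.aemeasurable.sub_const p).norm.inv.mul hGwm.norm.aemeasurable).aestronglyMeasurable
  refine Integrable.mono' hg hfm (ae_of_all _ fun x => ?_)
  rw [Real.norm_of_nonneg (mul_nonneg (inv_nonneg.mpr (norm_nonneg _)) (norm_nonneg _))]
  have h := inv_mul_opNorm_le (Gw x) (inv_nonneg.mpr (norm_nonneg (w x - p)))
  rw [inv_pow] at h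
  exact h

/-- The closing arithmetic of the shell bound: `I_H ≤ 36·A·I_w`, `I_w ≤ 3(X + Y + (M∕d)²Z)`, everything nonnegative ⇒
`I_H ≤ 108·A·(1 + M²)·(X + Y + d⁻²Z)`. [cite: HardtKinderlehrerLin1986, §2] -/
theorem shell_bound_arith {IH IW X Y Z A M d : ℝ} (hA : 0 ≤ A) (hX : 0 ≤ X) (hY : 0 ≤ Y) (hZ : 0 ≤ Z)
    (h1 : IH ≤ 36 * (A * IW)) (h2 : IW ≤ 3 * (X + Y + (M / d) ^ 2 * Z)) :
    IH ≤ 108 * A * (1 + M ^ 2) * (X + Y + d⁻¹ ^ 2 * Z) := by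
  have h3 : 36 * (A * IW) ≤ 36 * (A * (3 * (X + Y + (M / d) ^ 2 * Z))) :=
    mul_le_mul_of_nonneg_left (mul_le_mul_of_nonneg_left h2 hA) (by norm_num)
  have h4 : 36 * (A * (3 * (X + Y + (M / d) ^ 2 * Z))) ≤ 108 * A * (1 + M ^ 2) * (X + Y + d⁻¹ ^ 2 * Z) := by
    rw [div_eq_mul_inv, mul_pow]
    have hpos : 0 ≤ 108 * A * M ^ 2 * X + 108 * A * M ^ 2 * Y + 108 * A * d⁻¹ ^ 2 * Z := by positivity
    nlinarith [hpos]
  exact h1.trans (h3.trans h4)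

/-! ## §2 The HKL shell competitor -/

/-- **THE HARDT–KINDERLEHRER–LIN SHELL COMPETITOR**   An absolute `K ≥ 0` such that
for unit Sobolev `u, U` on the open unit cube with integrable densities, every centre `y` and radii `0 < ρ₁ < ρ₂` with `closedBall y ρ₂ ⊆ cube`,
there is a UNIT Sobolev `W` on the cube with integrable density, `W = U` on `ball y ρ₁`, `W = u` off `ball y ρ₂`, and
`∫_{B_{ρ₂} ∖ B_{ρ₁}} dens(GW) ≤ K·(∫ dens(GU) + ∫ dens(Gu) + (ρ₂ − ρ₁)⁻²·∫ ‖U − u‖²)` over the same shell.  `W` = the ray projection `π_p` of the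
cut-off interpolant `χ•U + (1−χ)•u` from an averaged centre `p` off the (countable) atom set, repaired to `u` on the null fibre `{w = p}`.
[cite: HardtKinderlehrerLin1986, §2] [cite: Simon1996, §2.8] -/
theorem exists_hkl_competitor :
    ∃ K : ℝ, 0 ≤ K ∧ ∀ (hQ : IsOpen {x : EuclideanSpace ℝ (Fin 3) | ∀ i : Fin 3, |x i| < 1})
      (u U : EuclideanSpace ℝ (Fin 3) → EuclideanSpace ℝ (Fin 4))
      (Gu GU : EuclideanSpace ℝ (Fin 3) → (EuclideanSpace ℝ (Fin 3) →L[ℝ] EuclideanSpace ℝ (Fin 4))),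
      HasWeakFDerivOn ⟨{x : EuclideanSpace ℝ (Fin 3) | ∀ i : Fin 3, |x i| < 1}, hQ⟩ volume u Gu →
      HasWeakFDerivOn ⟨{x : EuclideanSpace ℝ (Fin 3) | ∀ i : Fin 3, |x i| < 1}, hQ⟩ volume U GU →
      (∀ x : EuclideanSpace ℝ (Fin 3), (∀ i : Fin 3, |x i| < 1) → ‖u x‖ = 1) →
      (∀ x : EuclideanSpace ℝ (Fin 3), (∀ i : Fin 3, |x i| < 1) → ‖U x‖ = 1) →
      IntegrableOn (fun x => ∑ i : Fin 3, ‖Gu x (EuclideanSpace.single i (1:ℝ))‖ ^ 2)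
        {x : EuclideanSpace ℝ (Fin 3) | ∀ i : Fin 3, |x i| < 1} volume →
      IntegrableOn (fun x => ∑ i : Fin 3, ‖GU x (EuclideanSpace.single i (1:ℝ))‖ ^ 2)
        {x : EuclideanSpace ℝ (Fin 3) | ∀ i : Fin 3, |x i| < 1} volume →
      ∀ (y : EuclideanSpace ℝ (Fin 3)) (ρ₁ ρ₂ : ℝ), 0 < ρ₁ → ρ₁ < ρ₂ →
      closedBall y ρ₂ ⊆ {x : EuclideanSpace ℝ (Fin 3) | ∀ i : Fin 3, |x i| < 1} →
      ∃ (W : EuclideanSpace ℝ (Fin 3) → EuclideanSpace ℝ (Fin 4))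
        (GW : EuclideanSpace ℝ (Fin 3) → (EuclideanSpace ℝ (Fin 3) →L[ℝ] EuclideanSpace ℝ (Fin 4))),
        HasWeakFDerivOn ⟨{x : EuclideanSpace ℝ (Fin 3) | ∀ i : Fin 3, |x i| < 1}, hQ⟩ volume W GW ∧
        (∀ x : EuclideanSpace ℝ (Fin 3), (∀ i : Fin 3, |x i| < 1) → ‖W x‖ = 1) ∧
        IntegrableOn (fun x => ∑ i : Fin 3, ‖GW x (EuclideanSpace.single i (1:ℝ))‖ ^ 2)
          {x : EuclideanSpace ℝ (Fin 3) | ∀ i : Fin 3, |x i| < 1} volume ∧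
        (∀ x ∈ ball y ρ₁, W x = U x) ∧ (∀ x, x ∉ ball y ρ₂ → W x = u x) ∧
        ∫ x in ball y ρ₂ \ ball y ρ₁, ∑ i : Fin 3, ‖GW x (EuclideanSpace.single i (1:ℝ))‖ ^ 2 ≤
          K * ((∫ x in ball y ρ₂ \ ball y ρ₁, ∑ i : Fin 3, ‖GU x (EuclideanSpace.single i (1:ℝ))‖ ^ 2) +
            (∫ x in ball y ρ₂ \ ball y ρ₁, ∑ i : Fin 3, ‖Gu x (EuclideanSpace.single i (1:ℝ))‖ ^ 2) +
            (ρ₂ - ρ₁)⁻¹ ^ 2 * ∫ x in ball y ρ₂ \ ball y ρ₁, ‖U x - u x‖ ^ 2) := by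
  obtain ⟨M, hM0, hball⟩ := exists_ball_interpolant_energy
  set A : ℝ := (∫ x in ball (0 : EuclideanSpace ℝ (Fin 4)) 2, (‖x‖ ^ 2)⁻¹) /
    (volume (ball (0 : EuclideanSpace ℝ (Fin 4)) (1 / 2))).toReal with hA
  have hA0 : 0 ≤ A := averagingConst_nonneg
  refine ⟨108 * A * (1 + M ^ 2), by positivity, fun hQ u U Gu GU hu hU hu1 hU1 hdu hdU y ρ₁ ρ₂ h1 h12 hcb => ?_⟩
  set Q : Set (EuclideanSpace ℝ (Fin 3)) := {x | ∀ i : Fin 3, |x i| < 1} with hQdef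
  have hQm : MeasurableSet Q := hQ.measurableSet
  have hQfin : volume Q < ⊤ := volume_cube_lt_top
  have hd : 0 < ρ₂ - ρ₁ := sub_pos.mpr h12
  -- the sub-unit interpolant across the two balls (inner map `U`, outer map `u`)
  obtain ⟨w, Gw, hW, hsub, hin, hout, -, -, hS⟩ :=
    hball ⟨Q, hQ⟩ u U Gu GU hu hU (fun x hx => hu1 x hx) (fun x hx => hU1 x hx) hdu hdU y ρ₁ ρ₂ h1 h12
  -- the shell
  set S : Set (EuclideanSpace ℝ (Fin 3)) := ball y ρ₂ \ ball y ρ₁ with hSdef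
  have hSm : MeasurableSet S := measurableSet_ball.diff measurableSet_ball
  have hSQ : S ⊆ Q := fun x hx => hcb (ball_subset_closedBall hx.1)
  have hSfin : volume S < ⊤ := (measure_mono fun x (hx : x ∈ S) => hx.1).trans_lt measure_ball_lt_top
  obtain ⟨hdWS, hWS⟩ := hS S hSm hSQ hSfin
  obtain ⟨hdWQ, -⟩ := hS Q hQm Subset.rfl hQfin
  have hwm : AEStronglyMeasurable w (volume.restrict Q) := hW.locallyIntegrableOn.aestronglyMeasurable
  have hGwm : AEStronglyMeasurable Gw (volume.restrict Q) := hW.locallyIntegrableOn_deriv.aestronglyMeasurable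
  -- off the shell, inside the cube, `w` is unit
  have hcap : ∀ x ∈ Q, x ∉ S → ‖w x‖ = 1 := by
    intro x hxQ hxS
    by_cases h2 : x ∈ ball y ρ₂
    · have hx1 : x ∈ ball y ρ₁ := by
        by_contra h; exact hxS ⟨h2, h⟩
      rw [(hin x (mem_ball.1 hx1).le).1]
      exact hU1 x hxQ
    · rw [(hout x (not_lt.1 fun h => h2 (mem_ball.2 h))).1]
      exact hu1 x hxQ
  -- the countable atom set of `w` and the averaged centre
  obtain ⟨N, hNc, hNnull⟩ := exists_countable_null_fibres (volume.restrict Q) hwm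
  have hc0 : 0 ≤ᵐ[volume.restrict S] fun x => ∑ i : Fin 3, ‖Gw x (EuclideanSpace.single i (1:ℝ))‖ ^ 2 :=
    Filter.Eventually.of_forall fun x => show (0 : ℝ) ≤ _ from Finset.sum_nonneg fun i _ => by positivity
  have hq1 : ∀ᵐ x ∂(volume.restrict S), ‖w x‖ ≤ 1 :=
    (ae_restrict_iff' hSm).mpr (ae_of_all _ fun x hx => hsub x (hSQ hx))
  obtain ⟨p, hp, hpN, hSw, hSwle⟩ := exists_centre_weightedIntegral_le_of_countable volume S
    (fun x => ∑ i : Fin 3, ‖Gw x (EuclideanSpace.single i (1:ℝ))‖ ^ 2) w N hdWS hc0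
    (hwm.mono_measure (Measure.restrict_mono hSQ le_rfl)) hq1 hNc
  -- the weight on the whole cube, then the (C-b) row
  have hQw := integrableOn_weight_of_caps hQm hSm hp.le hwm hGwm hdWQ hSw hcap
  have hInt := integrableOn_inv_norm_mul_opNorm hQfin hwm hGwm hQw
  set H : EuclideanSpace ℝ (Fin 3) → (EuclideanSpace ℝ (Fin 3) →L[ℝ] EuclideanSpace ℝ (Fin 4)) := fun x =>
    (fderiv ℝ (fun z : EuclideanSpace ℝ (Fin 4) => p + (-⟪p, ‖z - p‖⁻¹ • (z - p)⟫ +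
      Real.sqrt (⟪p, ‖z - p‖⁻¹ • (z - p)⟫ ^ 2 + (1 - ‖p‖ ^ 2))) • (‖z - p‖⁻¹ • (z - p))) (w x)).comp (Gw x) with hHdef
  have hWH : HasWeakFDerivOn ⟨Q, hQ⟩ volume
      (fun x => p + (-⟪p, ‖w x - p‖⁻¹ • (w x - p)⟫ + Real.sqrt (⟪p, ‖w x - p‖⁻¹ • (w x - p)⟫ ^ 2 + (1 - ‖p‖ ^ 2))) •
        (‖w x - p‖⁻¹ • (w x - p))) H :=
    hasWeakFDerivOn_rayProj_comp hW p hp.le hInt.locallyIntegrableOn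
  have hHle : ∀ᵐ x ∂(volume.restrict Q), ∑ i : Fin 3, ‖H x (EuclideanSpace.single i (1:ℝ))‖ ^ 2 ≤
      36 * ((∑ i : Fin 3, ‖Gw x (EuclideanSpace.single i (1:ℝ))‖ ^ 2) * (‖w x - p‖ ^ 2)⁻¹) := by
    refine ae_of_all _ fun x => ?_
    have h := dens_rayProj_comp_le p hp.le (w := w) (Gw := Gw) x
    have e : (6 / ‖w x - p‖) ^ 2 * ∑ i : Fin 3, ‖Gw x (EuclideanSpace.single i (1:ℝ))‖ ^ 2 =
        36 * ((∑ i : Fin 3, ‖Gw x (EuclideanSpace.single i (1:ℝ))‖ ^ 2) * (‖w x - p‖ ^ 2)⁻¹) := by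
      rw [div_pow]; ring
    rw [← e]
    exact h
  -- the everywhere-unit representative
  obtain ⟨W, hW1, hWae, hWfix, hWout⟩ :=
    exists_unit_modification (u := u) hQm hp.le (fun x hx => hu1 x hx) (hNnull p hpN)
  have hWsob : HasWeakFDerivOn ⟨Q, hQ⟩ volume W H := hasWeakFDerivOn_congr_ae hWH hWae EventuallyEq.rfl
  have hHm : AEStronglyMeasurable H (volume.restrict Q) := hWH.locallyIntegrableOn_deriv.aestronglyMeasurable
  have hdHQ : IntegrableOn (fun x => ∑ i : Fin 3, ‖H x (EuclideanSpace.single i (1:ℝ))‖ ^ 2) Q volume := by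
    refine Integrable.mono' (hQw.const_mul 36) (aestronglyMeasurable_dens hHm) (hHle.mono fun x hx => ?_)
    rw [Real.norm_of_nonneg (Finset.sum_nonneg fun i _ => by positivity)]
    exact hx
  refine ⟨W, H, hWsob, fun x hx => hW1 x hx, hdHQ, fun x hx => ?_, fun x hx => ?_, ?_⟩
  · -- inner cap
    have hxQ : x ∈ Q := hcb (ball_subset_closedBall (ball_subset_ball h12.le hx))
    have hwx : w x = U x := (hin x (mem_ball.1 hx).le).1
    have h1x : ‖w x‖ = 1 := by rw [hwx]; exact hU1 x hxQ
    rw [hWfix x hxQ h1x, hwx]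
  · -- outer cap
    by_cases hxQ : x ∈ Q
    · have hwx : w x = u x := (hout x (not_lt.1 fun h => hx (mem_ball.2 h))).1
      have h1x : ‖w x‖ = 1 := by rw [hwx]; exact hu1 x hxQ
      rw [hWfix x hxQ h1x, hwx]
    · exact hWout x hxQ
  · -- the shell energy
    have hdHS : IntegrableOn (fun x => ∑ i : Fin 3, ‖H x (EuclideanSpace.single i (1:ℝ))‖ ^ 2) S volume := hdHQ.mono_set hSQ
    have h36 : IntegrableOn (fun x => 36 * ((∑ i : Fin 3, ‖Gw x (EuclideanSpace.single i (1:ℝ))‖ ^ 2) * (‖w x - p‖ ^ 2)⁻¹)) S volume :=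
      hSw.const_mul 36
    have step1 : ∫ x in S, ∑ i : Fin 3, ‖H x (EuclideanSpace.single i (1:ℝ))‖ ^ 2 ≤
        ∫ x in S, 36 * ((∑ i : Fin 3, ‖Gw x (EuclideanSpace.single i (1:ℝ))‖ ^ 2) * (‖w x - p‖ ^ 2)⁻¹) :=
      setIntegral_mono_ae_restrict hdHS h36 (ae_restrict_of_ae_restrict_of_subset hSQ hHle)
    have step2 : ∫ x in S, 36 * ((∑ i : Fin 3, ‖Gw x (EuclideanSpace.single i (1:ℝ))‖ ^ 2) * (‖w x - p‖ ^ 2)⁻¹) =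
        36 * ∫ x in S, (∑ i : Fin 3, ‖Gw x (EuclideanSpace.single i (1:ℝ))‖ ^ 2) * (‖w x - p‖ ^ 2)⁻¹ := integral_const_mul _ _
    have hX0 : 0 ≤ ∫ x in S, ∑ i : Fin 3, ‖GU x (EuclideanSpace.single i (1:ℝ))‖ ^ 2 :=
      setIntegral_nonneg hSm fun x _ => Finset.sum_nonneg fun i _ => by positivity
    have hY0 : 0 ≤ ∫ x in S, ∑ i : Fin 3, ‖Gu x (EuclideanSpace.single i (1:ℝ))‖ ^ 2 :=
      setIntegral_nonneg hSm fun x _ => Finset.sum_nonneg fun i _ => by positivity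
    have hZ0 : 0 ≤ ∫ x in S, ‖U x - u x‖ ^ 2 := setIntegral_nonneg hSm fun x _ => by positivity
    have e1 : ∫ x in S, ∑ i : Fin 3, ‖H x (EuclideanSpace.single i (1:ℝ))‖ ^ 2 ≤
        36 * (A * ∫ x in S, ∑ i : Fin 3, ‖Gw x (EuclideanSpace.single i (1:ℝ))‖ ^ 2) := by
      refine step1.trans ?_
      rw [step2]
      exact mul_le_mul_of_nonneg_left hSwle (by norm_num)
    exact shell_bound_arith hA0 hX0 hY0 hZ0 e1 hWS

end Literature.Analysis.PDE.MinimisingMaps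

end Part6

/-!
## Part 7 — port of `Summits/QuantumFields/YangMills/Theorems/PoincareLipschitzMinimisingMapCompactnessHolds.lean` (1 declarations kept)

# Energy minimising maps into `S³` (Hardt–Kinderlehrer–Lin / Luckhaus / Simon §2.9): Minimising Map Compactness Holds

Declarations of this Part (verbatim port; each keeps its own docstring and citation): `minimisingMapCompactness_holds`.

Reference keys (see `references.bib` and the declarations' citations): [Simon1996], [Luckhaus1988], [HardtKinderlehrerLin1986].
-/

section Part7

namespace Literature.Analysis.PDE.MinimisingMaps

/-- **(C) COMPACTNESS OF ENERGY MINIMISING MAPS `Q → S³`** (Luckhaus 1988; Simon 1996 §2.9 Lemma 1) — the named fact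
`Literature.Analysis.PDE.MinimisingMapCompactness` HOLDS (EXACT name; in-tree original
`Summit.QuantumFields.YangMills.Theorems.PoincareLipschitzMinimisingMapCompactnessHolds.minimisingMapCompactness_holds`): the assembly `minimisingMapCompactness_of_hkl`
fed with the Hardt–Kinderlehrer–Lin shell competitor `exists_hkl_competitor`. [cite: Simon1996, §2.9 Lemma 1 with Remarks (1)–(2);
Luckhaus1988, compactness theorem; HardtKinderlehrerLin1986, §2] -/
theorem _root_.Literature.Analysis.PDE.MinimisingMapCompactness_holds :
    Literature.Analysis.PDE.MinimisingMapCompactness := by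
  obtain ⟨K, hK, h⟩ := Literature.Analysis.PDE.MinimisingMaps.exists_hkl_competitor
  exact Literature.Analysis.PDE.MinimisingMaps.minimisingMapCompactness_of_hkl hK h

end Literature.Analysis.PDE.MinimisingMaps

end Part7

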